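import Mathlib
import HarnessLib

/-!
# Reducing the "intensity" of the singularity: Rice's subtractions (Davis–Rabinowitz 1984, Sect. 3.3.1)

Davis–Rabinowitz, *Methods of Numerical Integration* (2nd ed., 1984), Sect. 3.3 (infinite range, slowly
convergent integrals), Sect. 3.3.1: write the integrand as `f = g + r` where `∫_0^∞ g` is known in closed form
and `r(x) → 0` faster than `f(x)` as `x → ∞`; the numerical burden moves to `∫_0^∞ r`. Rice suggests
subtracting the simple integrals

* (3.3.1.1) `∫_0^∞ u⁻¹ sin(au) du = π/2` (`a > 0`), `= -π/2` (`a < 0`);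
* (3.3.1.2) `∫_0^∞ u⁻¹ [cos(au) - e^{-au}] du = 0`;
* (3.3.1.3) `∫_0^∞ cos(au)/(1+u²) du = (π/2) e^{-|a|}`;

(example: `∫_0^∞ x/(1+x²) sin x dx = π/2 - ∫_0^∞ (1+x²)⁻¹ (sin x/x) dx`), and, for integrands asymptotic to
`u^{-r} e^{iau}`, the family

* (3.3.1.4) `∫_0^∞ u^{-n-ε} (e^{-αu} - e^{-βu})^n du = (Γ(1-ε)/(ε)_n) Σ_{k=0}^{n} (-1)^{n-k} C(n,k) [(n-k)α + kβ]^{n+ε-1}`,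
* (3.3.1.5) `∫_0^∞ ((e^{-αu} - e^{-βu})/u)^n du = (1/(n-1)!) Σ_{k=0}^{n} (-1)^{n-k} C(n,k) [(n-k)α + kβ]^{n-1} log[(n-k)α + kβ]`,

`(ε)_0 = 1`, `(ε)_n = ε(ε+1)⋯(ε+n-1)`, for parameters "such that the integrals converge" (Rice [2]).

What is formalised here (Mathlib only):

* the subtraction principle as a theorem (`integral_Ioi_eq_add_of_split`: `f = g + r` on `(0,∞)` with `g`, `r`
  integrable there gives `∫ f = ∫ g + ∫ r`), the pointwise split of the worked example (`rice_example_split`,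
  `rice_example_split_sinc`) and the point of the example as a theorem: the remainder `(1+x²)⁻¹ (sin x/x)` is
  absolutely integrable (`integrable_rice_example_remainder`, `|r| ≤ (1+x²)⁻¹`);
* (3.3.1.1), (3.3.1.2) as NAMED FACTS in improper-integral (limit) form — the integrands are only conditionally
  integrable at `∞`, so a Bochner integral over `Ioi 0` would be the junk value — (`DirichletIntegral`,
  `RiceCosExpIntegral`); (3.3.1.3) as a NAMED FACT for the (absolutely convergent) Bochner integral
  (`LaplaceCosIntegral`) with its `a = 0` instance PROVED from Mathlib (`laplaceCosIntegral_zero`: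
  `∫_0^∞ (1+u²)⁻¹ du = π/2`);
* the right-hand sides of (3.3.1.4), (3.3.1.5) as functions (`riceEpsRHS`, `riceLogRHS`, real parameters; the
  Pochhammer symbol is Mathlib's `ascPochhammer`), the identities themselves as NAMED FACTS for real `α, β > 0`
  (`RiceEpsIntegral`, `RiceLogIntegral`), and the `n = 1` value of (3.3.1.5) PROVED to be the Frullani value
  `log β - log α` (`riceLogRHS_one`).

Not formalised: the complex parameters `α = -ia/n` used in Rice's examples, and the numerical examples. ALL FIVE
integrals are PROVED in the appended sections: (3.3.1.3) for every real `a` (`LaplaceCosIntegral_holds`, by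
Fourier inversion for `e^{-|x|}`), (3.3.1.1), (3.3.1.2) for every admissible `a` (`DirichletIntegral_holds`,
`RiceCosExpIntegral_holds`, by the Laplace-transform/Fubini argument `1/u = ∫_0^∞ e^{-xu} dx`), (3.3.1.5) for
every `n ≥ 1`, `α, β > 0` (`RiceLogIntegral_holds`: vanishing moments, `n - 1` integrations by parts, and
Frullani's integral), and (3.3.1.4) for every `n ≥ 1`, `α, β > 0` and non-integral `ε < 1`
(`RiceEpsIntegral_holds`: `n` integrations by parts with real powers and Euler's Gamma integral).
-/

open MeasureTheory Set Filter Topology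

namespace Literature.Analysis.Quadrature

/-! ## The subtraction principle -/

/-- **Rice's subtraction principle**: if `f = g + r` on `(0, ∞)` with `g` and `r` integrable there, then
`∫_0^∞ f = ∫_0^∞ g + ∫_0^∞ r` — the closed-form part `∫ g` is subtracted out and only `∫ r` is computed
numerically. [cite: DavisRabinowitz1984, Sect. 3.3.1] -/
theorem integral_Ioi_eq_add_of_split {f g r : ℝ → ℝ} (hfg : ∀ x ∈ Ioi (0 : ℝ), f x = g x + r x)
    (hg : IntegrableOn g (Ioi 0)) (hr : IntegrableOn r (Ioi 0)) :
    ∫ x in Ioi (0 : ℝ), f x = (∫ x in Ioi (0 : ℝ), g x) + ∫ x in Ioi (0 : ℝ), r x := by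
  rw [setIntegral_congr_fun measurableSet_Ioi hfg]
  exact integral_add hg hr

/-- The pointwise split of the worked example: `x/(1+x²) sin x = sin x / x - (1+x²)⁻¹ (sin x / x)` for
`x ≠ 0` (so that `∫_0^∞ x/(1+x²) sin x dx = π/2 - ∫_0^∞ (1+x²)⁻¹ (sin x/x) dx` by (3.3.1.1)).
[cite: DavisRabinowitz1984, Sect. 3.3.1] -/
theorem rice_example_split {x : ℝ} (hx : x ≠ 0) :
    x / (1 + x ^ 2) * Real.sin x = Real.sin x / x - 1 / (1 + x ^ 2) * (Real.sin x / x) := by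
  have h1 : (1 + x ^ 2) ≠ 0 := by positivity
  field_simp
  ring

/-- The same split written with Mathlib's `Real.sinc` (`sinc x = sin x / x` for `x ≠ 0`):
`x/(1+x²) sin x = sinc x - (1+x²)⁻¹ sinc x`. [cite: DavisRabinowitz1984, Sect. 3.3.1] -/
theorem rice_example_split_sinc {x : ℝ} (hx : x ≠ 0) :
    x / (1 + x ^ 2) * Real.sin x = Real.sinc x - (1 + x ^ 2)⁻¹ * Real.sinc x := by
  rw [Real.sinc_of_ne_zero hx, rice_example_split hx, one_div]

/-- The remainder of the worked example, `r(x) = (1+x²)⁻¹ (sin x / x)` (as `(1+x²)⁻¹ sinc x`), is absolutely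
integrable on `ℝ` — unlike the original integrand `x/(1+x²) sin x`, which is only conditionally integrable at
`∞`: the subtraction of (3.3.1.1) has reduced the "intensity" of the difficulty, `|r(x)| ≤ (1+x²)⁻¹`.
[cite: DavisRabinowitz1984, Sect. 3.3.1] -/
theorem integrable_rice_example_remainder :
    Integrable (fun x : ℝ => (1 + x ^ 2)⁻¹ * Real.sinc x) := by
  refine integrable_inv_one_add_sq.mono' ?_ (Filter.Eventually.of_forall fun x => ?_)
  · exact ((measurable_const.add (measurable_id.pow_const 2)).inv.mul
      Real.continuous_sinc.measurable).aestronglyMeasurable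
  · rw [Real.norm_eq_abs, abs_mul, abs_of_pos (by positivity : (0:ℝ) < (1 + x ^ 2)⁻¹)]
    exact mul_le_of_le_one_right (by positivity) (Real.abs_sinc_le_one x)

/-! ## Rice's simple integrals (3.3.1.1)–(3.3.1.3) -/

/-- NAMED FACT **(3.3.1.1)**, the Dirichlet integral in improper form:
`lim_{T→∞} ∫_0^T sin(au)/u du = π/2` for `a > 0` and `= -π/2` for `a < 0`; proved at the end of the file
(`DirichletIntegral_holds`). [cite: DavisRabinowitz1984, Sect. 3.3.1 (3.3.1.1)] -/
def DirichletIntegral (a : ℝ) : Prop :=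
  (0 < a → Tendsto (fun T : ℝ => ∫ u in (0 : ℝ)..T, Real.sin (a * u) / u) atTop (𝓝 (Real.pi / 2))) ∧
  (a < 0 → Tendsto (fun T : ℝ => ∫ u in (0 : ℝ)..T, Real.sin (a * u) / u) atTop (𝓝 (-(Real.pi / 2))))

/-- NAMED FACT **(3.3.1.2)** in improper form: `lim_{T→∞} ∫_0^T [cos(au) - e^{-au}]/u du = 0` (`a > 0`);
proved at the end of the file (`RiceCosExpIntegral_holds`). [cite: DavisRabinowitz1984, Sect. 3.3.1 (3.3.1.2)] -/
def RiceCosExpIntegral (a : ℝ) : Prop :=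
  0 < a → Tendsto (fun T : ℝ => ∫ u in (0 : ℝ)..T, (Real.cos (a * u) - Real.exp (-(a * u))) / u)
    atTop (𝓝 0)

/-- NAMED FACT **(3.3.1.3)** (Laplace): `∫_0^∞ cos(au)/(1+u²) du = (π/2) e^{-|a|}` (absolutely convergent,
stated for the Bochner integral over `(0, ∞)`); proved for `a = 0` below and for every `a` at the end of the
file (`LaplaceCosIntegral_holds`). [cite: DavisRabinowitz1984, Sect. 3.3.1 (3.3.1.3)] -/
def LaplaceCosIntegral (a : ℝ) : Prop :=
  ∫ u in Ioi (0 : ℝ), Real.cos (a * u) / (1 + u ^ 2) = Real.pi / 2 * Real.exp (-|a|)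

/-- The `a = 0` instance of (3.3.1.3) holds: `∫_0^∞ du/(1+u²) = π/2` (Mathlib's `integral_Ioi_inv_one_add_sq`).
[cite: DavisRabinowitz1984, Sect. 3.3.1 (3.3.1.3)] -/
theorem laplaceCosIntegral_zero : LaplaceCosIntegral 0 := by
  unfold LaplaceCosIntegral
  simp only [zero_mul, Real.cos_zero, abs_zero, neg_zero, Real.exp_zero, mul_one, one_div]
  rw [integral_Ioi_inv_one_add_sq, Real.arctan_zero, sub_zero]

/-! ## Rice's family (3.3.1.4)–(3.3.1.5) -/

/-- The right-hand side of (3.3.1.4):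
`(Γ(1-ε)/(ε)_n) Σ_{k=0}^{n} (-1)^{n-k} C(n,k) [(n-k)α + kβ]^{n+ε-1}` (real parameters; `(ε)_n` is the rising
factorial `ascPochhammer`). [cite: DavisRabinowitz1984, Sect. 3.3.1 (3.3.1.4)] -/
noncomputable def riceEpsRHS (n : ℕ) (ε α β : ℝ) : ℝ :=
  Real.Gamma (1 - ε) / (ascPochhammer ℝ n).eval ε *
    ∑ k ∈ Finset.range (n + 1),
      (-1 : ℝ) ^ (n - k) * (n.choose k : ℝ) * (((n : ℝ) - k) * α + k * β) ^ ((n : ℝ) + ε - 1)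

/-- The right-hand side of (3.3.1.5):
`(1/(n-1)!) Σ_{k=0}^{n} (-1)^{n-k} C(n,k) [(n-k)α + kβ]^{n-1} log[(n-k)α + kβ]` (real parameters).
[cite: DavisRabinowitz1984, Sect. 3.3.1 (3.3.1.5)] -/
noncomputable def riceLogRHS (n : ℕ) (α β : ℝ) : ℝ :=
  1 / ((n - 1).factorial : ℝ) *
    ∑ k ∈ Finset.range (n + 1),
      (-1 : ℝ) ^ (n - k) * (n.choose k : ℝ) * (((n : ℝ) - k) * α + k * β) ^ (n - 1) *
        Real.log (((n : ℝ) - k) * α + k * β)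

/-- NAMED FACT **(3.3.1.4)** for real `α, β > 0`, `n ≥ 1` and non-integral `ε < 1` (so that the integral
converges at `0` and the right-hand side is defined):
`∫_0^∞ u^{-n-ε} (e^{-αu} - e^{-βu})^n du = riceEpsRHS n ε α β`; proved at the end of the file
(`RiceEpsIntegral_holds`). [cite: DavisRabinowitz1984, Sect. 3.3.1 (3.3.1.4)] -/
def RiceEpsIntegral (n : ℕ) (ε α β : ℝ) : Prop :=
  1 ≤ n → 0 < α → 0 < β → ε < 1 → (∀ m : ℤ, ε ≠ m) →
    ∫ u in Ioi (0 : ℝ), u ^ (-(n : ℝ) - ε) * (Real.exp (-(α * u)) - Real.exp (-(β * u))) ^ n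
      = riceEpsRHS n ε α β

/-- NAMED FACT **(3.3.1.5)** for real `α, β > 0` and `n ≥ 1`:
`∫_0^∞ ((e^{-αu} - e^{-βu})/u)^n du = riceLogRHS n α β`; proved at the end of the file
(`RiceLogIntegral_holds`). [cite: DavisRabinowitz1984, Sect. 3.3.1 (3.3.1.5)] -/
def RiceLogIntegral (n : ℕ) (α β : ℝ) : Prop :=
  1 ≤ n → 0 < α → 0 < β →
    ∫ u in Ioi (0 : ℝ), ((Real.exp (-(α * u)) - Real.exp (-(β * u))) / u) ^ n = riceLogRHS n α β

/-- For `n = 1` the right-hand side of (3.3.1.5) is the Frullani value `log β - log α`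
(`∫_0^∞ (e^{-αu} - e^{-βu})/u du = log(β/α)`). [cite: DavisRabinowitz1984, Sect. 3.3.1 (3.3.1.5)] -/
theorem riceLogRHS_one (α β : ℝ) : riceLogRHS 1 α β = Real.log β - Real.log α := by
  unfold riceLogRHS
  simp [Finset.sum_range_succ]
  ring

/-- For `n = 1` the (3.3.1.5) statement reads `∫_0^∞ (e^{-αu} - e^{-βu})/u du = log β - log α`.
[cite: DavisRabinowitz1984, Sect. 3.3.1 (3.3.1.5)] -/
theorem riceLogIntegral_one_iff (α β : ℝ) :
    RiceLogIntegral 1 α β ↔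
      (0 < α → 0 < β →
        ∫ u in Ioi (0 : ℝ), (Real.exp (-(α * u)) - Real.exp (-(β * u))) / u = Real.log β - Real.log α) := by
  unfold RiceLogIntegral
  simp only [le_refl, pow_one, riceLogRHS_one, forall_true_left]

/-- The `(ε)_n` normalisation: `(ε)_0 = 1` and `(ε)_1 = ε`, as in the text. [cite: DavisRabinowitz1984, Sect. 3.3.1 (3.3.1.4)] -/
theorem ascPochhammer_eval_zero_one (ε : ℝ) :
    (ascPochhammer ℝ 0).eval ε = 1 ∧ (ascPochhammer ℝ 1).eval ε = ε := by
  simp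

end Literature.Analysis.Quadrature

/-! ## Proof of (3.3.1.3) for every real `a` (`LaplaceCosIntegral_holds`)

The Laplace integral `∫_0^∞ cos(au)/(1+u²) du = (π/2) e^{-|a|}` is obtained from Mathlib's Fourier
inversion theorem (`MeasureTheory.Integrable.fourierInv_fourier_eq`) applied to the continuous integrable
function `e^{-|x|}`, whose Fourier transform `∫ e^{-2πixw} e^{-|x|} dx = 1/(1 - 2πiw) + 1/(1 + 2πiw)
= 2/(1 + 4π²w²)` is computed from the two half-line exponential integrals
(`integral_exp_mul_complex_Ioi` / `integral_exp_mul_complex_Iic`) and is integrable; inversion at `a`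
gives `∫ e^{2πiwa} · 2/(1 + 4π²w²) dw = e^{-|a|}`, the substitution `u = 2πw` and real parts give
`∫_ℝ cos(au)/(1+u²) du = π e^{-|a|}`, and the integrand is even (`integral_comp_abs`).
-/

open scoped FourierTransform

namespace Literature.Analysis.Quadrature

section LaplaceCosIntegralProof

/-- The function `e^{-|v|}`, complex-valued. [folklore] -/
private noncomputable def expNegAbs (v : ℝ) : ℂ := ((Real.exp (-|v|) : ℝ) : ℂ)

/-- `e^{-|v|}` is integrable on `ℝ`. [folklore] -/
private theorem integrable_exp_neg_abs_real : Integrable (fun v : ℝ => Real.exp (-|v|)) := by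
  have h1 : IntegrableOn (fun v : ℝ => Real.exp (-|v|)) (Ioi 0) := by
    refine (exp_neg_integrableOn_Ioi 0 one_pos).congr_fun (fun v hv => ?_) measurableSet_Ioi
    rw [abs_of_pos (mem_Ioi.1 hv)]
    ring_nf
  have h2 : IntegrableOn (fun v : ℝ => Real.exp (-|v|)) (Iic 0) := by
    refine (integrableOn_exp_Iic 0).congr_fun (fun v hv => ?_) measurableSet_Iic
    show Real.exp v = Real.exp (-|v|)
    rw [abs_of_nonpos (mem_Iic.1 hv), neg_neg]
  have := h2.union h1
  rwa [Iic_union_Ioi, integrableOn_univ] at this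

/-- `expNegAbs` is integrable. [folklore] -/
private theorem integrable_expNegAbs : Integrable expNegAbs :=
  integrable_exp_neg_abs_real.ofReal

/-- `expNegAbs` is continuous. [folklore] -/
private theorem continuous_expNegAbs : Continuous expNegAbs :=
  Complex.continuous_ofReal.comp (Real.continuous_exp.comp continuous_abs.neg)

/-- The Fourier transform of `e^{-|v|}`: `𝓕(e^{-|·|})(w) = 2/(1 + 4π²w²)`. [folklore] -/
private theorem fourier_expNegAbs (w : ℝ) :
    𝓕 expNegAbs w = (((2 / (1 + 4 * Real.pi ^ 2 * w ^ 2) : ℝ)) : ℂ) := by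
  rw [Real.fourier_real_eq_integral_exp_smul]
  simp only [smul_eq_mul]
  -- the integrand and its integrability on the two half-lines
  set F : ℝ → ℂ := fun v => Complex.exp (↑(-2 * Real.pi * v * w) * Complex.I) * expNegAbs v with hF
  have hFint : Integrable F := by
    refine integrable_expNegAbs.norm.mono' ?_ (Eventually.of_forall fun v => ?_)
    · exact ((Complex.continuous_exp.comp (by fun_prop)).mul continuous_expNegAbs).aestronglyMeasurable
    · rw [hF]
      simp only [norm_mul, Complex.norm_exp_ofReal_mul_I, one_mul, le_refl]
  -- right half-line
  set a₁ : ℂ := -1 - 2 * Real.pi * w * Complex.I with ha₁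
  have ha₁re : a₁.re < 0 := by simp [ha₁]
  have hright : ∫ v in Ioi (0 : ℝ), F v = 1 / (1 + 2 * Real.pi * w * Complex.I) := by
    have hcongr : EqOn F (fun v : ℝ => Complex.exp (a₁ * v)) (Ioi 0) := by
      intro v hv
      simp only [hF, expNegAbs, abs_of_pos (mem_Ioi.1 hv), Complex.ofReal_exp, ← Complex.exp_add]
      congr 1
      push_cast
      ring
    rw [setIntegral_congr_fun measurableSet_Ioi hcongr, integral_exp_mul_complex_Ioi ha₁re 0]
    have hneg : a₁ = -(1 + 2 * Real.pi * w * Complex.I) := by rw [ha₁]; ring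
    simp only [Complex.ofReal_zero, mul_zero, Complex.exp_zero]
    rw [hneg, neg_div_neg_eq]
  -- left half-line
  set a₂ : ℂ := 1 - 2 * Real.pi * w * Complex.I with ha₂
  have ha₂re : 0 < a₂.re := by simp [ha₂]
  have hleft : ∫ v in Iic (0 : ℝ), F v = 1 / (1 - 2 * Real.pi * w * Complex.I) := by
    have hcongr : EqOn F (fun v : ℝ => Complex.exp (a₂ * v)) (Iic 0) := by
      intro v hv
      simp only [hF, expNegAbs, abs_of_nonpos (mem_Iic.1 hv), neg_neg, Complex.ofReal_exp,
        ← Complex.exp_add]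
      congr 1
      push_cast
      ring
    rw [setIntegral_congr_fun measurableSet_Iic hcongr, integral_exp_mul_complex_Iic ha₂re 0]
    simp only [Complex.ofReal_zero, mul_zero, Complex.exp_zero]
    rw [ha₂]
  rw [← intervalIntegral.integral_Iic_add_Ioi hFint.integrableOn hFint.integrableOn, hleft, hright]
  have h1 : (1 + 2 * Real.pi * w * Complex.I) ≠ 0 := by
    intro h; have := congrArg Complex.re h; simp at this
  have h2 : (1 - 2 * Real.pi * w * Complex.I) ≠ 0 := by
    intro h; have := congrArg Complex.re h; simp at this
  have hprod : (1 - 2 * Real.pi * w * Complex.I) * (1 + 2 * Real.pi * w * Complex.I) =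
      1 + 4 * (Real.pi : ℂ) ^ 2 * (w : ℂ) ^ 2 := by
    linear_combination (-4 * (Real.pi : ℂ) ^ 2 * (w : ℂ) ^ 2) * Complex.I_sq
  push_cast
  rw [div_add_div _ _ h2 h1, hprod]
  congr 1
  ring

/-- `𝓕(e^{-|·|})` is integrable. [folklore] -/
private theorem integrable_fourier_expNegAbs : Integrable (𝓕 expNegAbs) := by
  have h : 𝓕 expNegAbs = fun w : ℝ => (((2 * (1 + (2 * Real.pi * w) ^ 2)⁻¹ : ℝ)) : ℂ) := by
    funext w
    rw [fourier_expNegAbs]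
    congr 1
    rw [div_eq_mul_inv]
    congr 2
    ring
  rw [h]
  exact ((integrable_inv_one_add_sq.comp_mul_left' (by positivity : (2 * Real.pi : ℝ) ≠ 0)).const_mul
    2).ofReal

/-- Fourier inversion at `a`: `∫ e^{2πiwa} · 2/(1 + 4π²w²) dw = e^{-|a|}`. [folklore] -/
private theorem integral_fourier_expNegAbs (a : ℝ) :
    ∫ w : ℝ, Complex.exp (↑(2 * Real.pi * w * a) * Complex.I) *
      (((2 / (1 + 4 * Real.pi ^ 2 * w ^ 2) : ℝ)) : ℂ) = ((Real.exp (-|a|) : ℝ) : ℂ) := by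
  have hinv := integrable_expNegAbs.fourierInv_fourier_eq integrable_fourier_expNegAbs
    (continuous_expNegAbs.continuousAt (x := a))
  rw [Real.fourierInv_eq_fourier_neg, Real.fourier_real_eq_integral_exp_smul] at hinv
  simp only [smul_eq_mul, fourier_expNegAbs] at hinv
  rw [show ((Real.exp (-|a|) : ℝ) : ℂ) = expNegAbs a from rfl, ← hinv]
  refine integral_congr_ae (Eventually.of_forall fun w => ?_)
  push_cast
  ring_nf

/-- After the substitution `u = 2πw`: `∫ e^{iua} · 2/(1+u²) du = 2π e^{-|a|}`. [folklore] -/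
private theorem integral_cexp_mul_two_div (a : ℝ) :
    ∫ u : ℝ, Complex.exp (↑(u * a) * Complex.I) * (((2 / (1 + u ^ 2) : ℝ)) : ℂ) =
      (((2 * Real.pi * Real.exp (-|a|)) : ℝ) : ℂ) := by
  set G : ℝ → ℂ := fun u => Complex.exp (↑(u * a) * Complex.I) * (((2 / (1 + u ^ 2) : ℝ)) : ℂ)
    with hG
  have hscale := Measure.integral_comp_mul_left G (2 * Real.pi)
  have hG2 : (fun w : ℝ => G (2 * Real.pi * w)) = fun w : ℝ =>
      Complex.exp (↑(2 * Real.pi * w * a) * Complex.I) *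
        (((2 / (1 + 4 * Real.pi ^ 2 * w ^ 2) : ℝ)) : ℂ) := by
    funext w
    simp only [hG]
    congr 3
    ring
  rw [hG2, integral_fourier_expNegAbs] at hscale
  have hpi : (0 : ℝ) < 2 * Real.pi := by positivity
  rw [abs_of_pos (inv_pos.2 hpi), Complex.real_smul] at hscale
  -- `e^{-|a|} = (2π)⁻¹ ∫ G`, so `∫ G = 2π e^{-|a|}`
  have hne : (((2 * Real.pi)⁻¹ : ℝ) : ℂ) ≠ 0 := by
    rw [Ne, Complex.ofReal_eq_zero]; positivity
  calc ∫ u : ℝ, G u = ((2 * Real.pi : ℝ) : ℂ) * ((((2 * Real.pi)⁻¹ : ℝ) : ℂ) * ∫ u : ℝ, G u) := by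
        rw [← mul_assoc, ← Complex.ofReal_mul, mul_inv_cancel₀ hpi.ne', Complex.ofReal_one, one_mul]
    _ = ((2 * Real.pi : ℝ) : ℂ) * ((Real.exp (-|a|) : ℝ) : ℂ) := by rw [← hscale]
    _ = (((2 * Real.pi * Real.exp (-|a|)) : ℝ) : ℂ) := by push_cast; ring

/-- Real part: `∫ cos(au) · 2/(1+u²) du = 2π e^{-|a|}` over `ℝ`. [folklore] -/
private theorem integral_cos_mul_two_div (a : ℝ) :
    ∫ u : ℝ, Real.cos (a * u) * (2 / (1 + u ^ 2)) = 2 * Real.pi * Real.exp (-|a|) := by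
  have hGint : Integrable (fun u : ℝ =>
      Complex.exp (↑(u * a) * Complex.I) * (((2 / (1 + u ^ 2) : ℝ)) : ℂ)) := by
    have hr : Integrable (fun u : ℝ => 2 * (1 + u ^ 2)⁻¹) := integrable_inv_one_add_sq.const_mul 2
    refine hr.mono' ?_ (Eventually.of_forall fun u => ?_)
    · exact ((Complex.continuous_exp.comp (by fun_prop)).mul
        (Complex.continuous_ofReal.comp
          (continuous_const.div (by fun_prop) fun u => by positivity))).aestronglyMeasurable
    · rw [norm_mul, Complex.norm_exp_ofReal_mul_I, one_mul, Complex.norm_real, Real.norm_eq_abs,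
        abs_of_nonneg (by positivity), div_eq_mul_inv]
  have hre := integral_re hGint
  rw [integral_cexp_mul_two_div] at hre
  simp only [RCLike.re_to_complex, Complex.ofReal_re] at hre
  rw [← hre]
  refine integral_congr_ae (Eventually.of_forall fun u => ?_)
  simp only [Complex.re_mul_ofReal, Complex.exp_ofReal_mul_I_re, mul_comm u a]

/-- **(3.3.1.3) for every real `a`** (Laplace): `∫_0^∞ cos(au)/(1+u²) du = (π/2) e^{-|a|}`, by Fourier
inversion for `e^{-|x|}` (whose Fourier transform is `2/(1 + 4π²w²)`), the substitution `u = 2πw`,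
taking real parts, and halving the integral of the even integrand. Discharge of the named fact
`LaplaceCosIntegral`. [cite: DavisRabinowitz1984, Sect. 3.3.1 (3.3.1.3)] -/
theorem LaplaceCosIntegral_holds : ∀ a : ℝ, LaplaceCosIntegral a := by
  intro a
  unfold LaplaceCosIntegral
  have heven : (fun u : ℝ => Real.cos (a * |u|) / (1 + |u| ^ 2)) = fun u : ℝ =>
      Real.cos (a * u) / (1 + u ^ 2) := by
    funext u
    rw [sq_abs]
    rcases le_or_gt 0 u with hu | hu
    · rw [abs_of_nonneg hu]
    · rw [abs_of_neg hu, mul_neg, Real.cos_neg]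
  have h2 := integral_comp_abs (f := fun u : ℝ => Real.cos (a * u) / (1 + u ^ 2))
  rw [heven] at h2
  have hfull : ∫ u : ℝ, Real.cos (a * u) / (1 + u ^ 2) = Real.pi * Real.exp (-|a|) := by
    have := integral_cos_mul_two_div a
    have hrw : (fun u : ℝ => Real.cos (a * u) * (2 / (1 + u ^ 2))) =
        fun u : ℝ => 2 * (Real.cos (a * u) / (1 + u ^ 2)) := by
      funext u; ring
    rw [hrw, integral_const_mul] at this
    linarith
  linarith

end LaplaceCosIntegralProof

/-! ## Proofs of (3.3.1.1) and (3.3.1.2) (`DirichletIntegral_holds`, `RiceCosExpIntegral_holds`)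

Both limits are obtained from the Laplace-transform representation `1/u = ∫_0^∞ e^{-xu} dx` (`u > 0`):
for `φ` continuous with `|φ(u)| ≤ C u` on `[0, ∞)` the double integral `∫_0^T ∫_0^∞ e^{-xu} φ(u) dx du` is
absolutely convergent, so by Fubini `∫_0^T φ(u)/u du = ∫_0^∞ (∫_0^T e^{-xu} φ(u) du) dx`
(`intervalIntegral_div_eq_integral_laplace`). For `φ = sin` the inner integral is
`(1 - e^{-xT}(x sin T + cos T))/(1+x²)`, whence `∫_0^T sin u/u du = π/2 - (tail)` with `|tail| ≤ 2/T`;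
for `φ(u) = cos u - e^{-u}` the inner integral is `x/(1+x²) - 1/(x+1)` (whose integral over `(0, ∞)`
vanishes: antiderivative `½ log(1+x²) - log(1+x) → log 1 = 0`) plus a tail bounded by `3 e^{-Tx}`, whence
`|∫_0^T (cos u - e^{-u})/u du| ≤ 3/T`. The parameter `a` is removed by the substitution `v = au`.
-/

section DirichletIntegralProof

/-- `d/du (-(c u)) = -c`. [folklore] -/
private theorem hasDerivAt_neg_const_mul (c u : ℝ) : HasDerivAt (fun u : ℝ => -(c * u)) (-c) u := by
  have h := (hasDerivAt_id u).const_mul (-c)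
  simpa [neg_mul] using h

/-- `x ↦ x/(1+x²)` is continuous. [folklore] -/
private theorem continuous_div_one_add_sq : Continuous fun x : ℝ => x / (1 + x ^ 2) :=
  continuous_id.div (by fun_prop) fun x => by positivity

/-- `1/u = ∫_0^∞ e^{-ux} dx` for `u > 0`. [folklore] -/
private theorem integral_exp_neg_mul_Ioi {u : ℝ} (hu : 0 < u) :
    ∫ x in Ioi (0 : ℝ), Real.exp (-(u * x)) = 1 / u := by
  have h := integral_exp_mul_Ioi (a := -u) (by linarith) 0
  simp only [mul_zero, Real.exp_zero] at h
  rw [show (fun x : ℝ => Real.exp (-(u * x))) = fun x : ℝ => Real.exp (-u * x) from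
    funext fun x => by rw [neg_mul], h]
  field_simp

/-- **Laplace-transform representation.** If `φ` is continuous with `|φ(u)| ≤ C u` for `u ≥ 0`, then for
`T ≥ 0`, `∫_0^T φ(u)/u du = ∫_0^∞ (∫_0^T e^{-xu} φ(u) du) dx` (Fubini, the double integral being absolutely
convergent: `∫_0^∞ e^{-xu} |φ(u)| dx = |φ(u)|/u ≤ C`). [folklore] -/
private theorem intervalIntegral_div_eq_integral_laplace {φ : ℝ → ℝ} (hφc : Continuous φ) {C : ℝ}
    (hφ : ∀ u, 0 ≤ u → |φ u| ≤ C * u) {T : ℝ} (hT : 0 ≤ T) :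
    ∫ u in (0 : ℝ)..T, φ u / u =
      ∫ x in Ioi (0 : ℝ), ∫ u in (0 : ℝ)..T, Real.exp (-(x * u)) * φ u := by
  -- the integrand of the double integral
  set F : ℝ → ℝ → ℝ := fun u x => Real.exp (-(u * x)) * φ u with hF
  have hFcont : Continuous (Function.uncurry F) := by
    simp only [hF, Function.uncurry_def]
    fun_prop
  -- integrability on `(Ioc 0 T) × (Ioi 0)`
  have hint : Integrable (Function.uncurry F)
      ((volume.restrict (Ioc (0 : ℝ) T)).prod (volume.restrict (Ioi (0 : ℝ)))) := by
    refine (integrable_prod_iff hFcont.aestronglyMeasurable).2 ⟨?_, ?_⟩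
    · refine (ae_restrict_iff' measurableSet_Ioc).2 (Eventually.of_forall fun u hu => ?_)
      simp only [Function.uncurry_apply_pair, hF]
      have hu0 : 0 < u := hu.1
      have hexp : IntegrableOn (fun x : ℝ => Real.exp (-(u * x))) (Ioi 0) := by
        have := exp_neg_integrableOn_Ioi 0 hu0
        refine this.congr_fun (fun x _ => ?_) measurableSet_Ioi
        simp only [neg_mul]
      exact hexp.mul_const _
    · -- `u ↦ ∫_0^∞ |e^{-ux} φ(u)| dx = |φ u| / u` is bounded by `C` on `Ioc 0 T`
      have hbound : IntegrableOn (fun _ : ℝ => C) (Ioc (0 : ℝ) T) := integrableOn_const measure_Ioc_lt_top.ne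
      refine hbound.mono' ?_ ?_
      · -- measurability: the function agrees on `Ioc 0 T` with the continuous `|φ u| / u`
        have hmeas : AEStronglyMeasurable (fun u : ℝ => |φ u| / u) (volume.restrict (Ioc (0 : ℝ) T)) :=
          (Measurable.aestronglyMeasurable (by fun_prop))
        refine hmeas.congr ?_
        refine (ae_restrict_iff' measurableSet_Ioc).2 (Eventually.of_forall fun u hu => ?_)
        simp only [Function.uncurry_apply_pair, hF, norm_mul, Real.norm_eq_abs, Real.abs_exp]
        rw [integral_mul_const, integral_exp_neg_mul_Ioi hu.1]
        field_simp
      · refine (ae_restrict_iff' measurableSet_Ioc).2 (Eventually.of_forall fun u hu => ?_)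
        simp only [Function.uncurry_apply_pair, hF, norm_mul, Real.norm_eq_abs, Real.abs_exp]
        rw [integral_mul_const, integral_exp_neg_mul_Ioi hu.1]
        rw [abs_of_nonneg (by have := hu.1.le; positivity), one_div, inv_mul_le_iff₀ hu.1, mul_comm]
        exact hφ u hu.1.le
  -- rewrite the left-hand side as a double integral and swap
  rw [intervalIntegral.integral_of_le hT]
  have hlhs : ∫ u in Ioc (0 : ℝ) T, φ u / u = ∫ u in Ioc (0 : ℝ) T, ∫ x in Ioi (0 : ℝ), F u x := by
    refine setIntegral_congr_fun measurableSet_Ioc (fun u hu => ?_)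
    simp only [hF]
    rw [integral_mul_const, integral_exp_neg_mul_Ioi hu.1]
    field_simp
  rw [hlhs, integral_integral_swap hint]
  refine setIntegral_congr_fun measurableSet_Ioi (fun x _ => ?_)
  rw [intervalIntegral.integral_of_le hT]
  refine setIntegral_congr_fun measurableSet_Ioc (fun u _ => ?_)
  simp only [hF, mul_comm x u]

/-- `∫_0^T e^{-xu} sin u du = (1 - e^{-xT}(x sin T + cos T))/(1+x²)`. [folklore] -/
private theorem intervalIntegral_exp_neg_mul_sin (x T : ℝ) :
    ∫ u in (0 : ℝ)..T, Real.exp (-(x * u)) * Real.sin u =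
      (1 - Real.exp (-(x * T)) * (x * Real.sin T + Real.cos T)) / (1 + x ^ 2) := by
  have hx : (1 + x ^ 2) ≠ 0 := by positivity
  have hderiv : ∀ u : ℝ, HasDerivAt
      (fun u : ℝ => -(Real.exp (-(x * u)) * (x * Real.sin u + Real.cos u)) / (1 + x ^ 2))
      (Real.exp (-(x * u)) * Real.sin u) u := by
    intro u
    have h2 : HasDerivAt (fun u : ℝ => Real.exp (-(x * u))) (Real.exp (-(x * u)) * -x) u :=
      (Real.hasDerivAt_exp _).comp u (hasDerivAt_neg_const_mul x u)
    have h3 : HasDerivAt (fun u : ℝ => x * Real.sin u + Real.cos u) (x * Real.cos u + -Real.sin u) u :=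
      ((Real.hasDerivAt_sin u).const_mul x).add (Real.hasDerivAt_cos u)
    have h4 : HasDerivAt (fun u : ℝ => -(Real.exp (-(x * u)) * (x * Real.sin u + Real.cos u)) / (1 + x ^ 2))
        (-(Real.exp (-(x * u)) * -x * (x * Real.sin u + Real.cos u) +
          Real.exp (-(x * u)) * (x * Real.cos u + -Real.sin u)) / (1 + x ^ 2)) u :=
      ((h2.mul h3).neg).div_const (1 + x ^ 2)
    refine h4.congr_deriv ?_
    field_simp
    ring
  rw [intervalIntegral.integral_eq_sub_of_hasDerivAt (fun u _ => hderiv u)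
    ((by fun_prop : Continuous fun u : ℝ => Real.exp (-(x * u)) * Real.sin u).intervalIntegrable _ _)]
  simp only [mul_zero, neg_zero, Real.exp_zero, Real.sin_zero, Real.cos_zero]
  field_simp
  ring

/-- The Dirichlet integral up to `T ≥ 0` in Laplace form:
`∫_0^T sin u/u du = π/2 - ∫_0^∞ e^{-xT}(x sin T + cos T)/(1+x²) dx`. [folklore] -/
private theorem intervalIntegral_sin_div_eq (T : ℝ) (hT : 0 ≤ T) :
    ∫ u in (0 : ℝ)..T, Real.sin u / u = Real.pi / 2 -
      ∫ x in Ioi (0 : ℝ), Real.exp (-(x * T)) * (x * Real.sin T + Real.cos T) / (1 + x ^ 2) := by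
  have hrep := intervalIntegral_div_eq_integral_laplace Real.continuous_sin (C := 1)
    (fun u hu => by simpa using Real.abs_sin_le_abs.trans_eq' rfl |>.trans (le_of_eq (abs_of_nonneg hu)))
    hT
  rw [hrep]
  simp_rw [intervalIntegral_exp_neg_mul_sin]
  -- split `(1 - R)/(1+x²) = (1+x²)⁻¹ - R/(1+x²)`
  have hsplit : ∀ x : ℝ, (1 - Real.exp (-(x * T)) * (x * Real.sin T + Real.cos T)) / (1 + x ^ 2) =
      (1 + x ^ 2)⁻¹ - Real.exp (-(x * T)) * (x * Real.sin T + Real.cos T) / (1 + x ^ 2) := by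
    intro x
    rw [sub_div, one_div]
  simp_rw [hsplit]
  have htail : IntegrableOn
      (fun x : ℝ => Real.exp (-(x * T)) * (x * Real.sin T + Real.cos T) / (1 + x ^ 2)) (Ioi 0) := by
    -- `T = 0`: the integrand is `(1+x²)⁻¹`; `T > 0`: dominated by `2 e^{-Tx}` (`|x sin T + cos T| ≤ x + 1 ≤ 2(1+x²)`)
    rcases hT.eq_or_lt with rfl | hT'
    · simp only [mul_zero, neg_zero, Real.exp_zero, one_mul, Real.sin_zero, Real.cos_zero, zero_add]
      simpa [one_div] using integrable_inv_one_add_sq.integrableOn (s := Ioi (0 : ℝ))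
    · have hdom : IntegrableOn (fun x : ℝ => 2 * Real.exp (-T * x)) (Ioi 0) :=
        (exp_neg_integrableOn_Ioi 0 hT').const_mul 2
      have hcont : Continuous fun x : ℝ => Real.exp (-(x * T)) * (x * Real.sin T + Real.cos T) /
          (1 + x ^ 2) :=
        (by fun_prop : Continuous fun x : ℝ => Real.exp (-(x * T)) * (x * Real.sin T + Real.cos T)).div
          (by fun_prop) (fun x => by positivity)
      refine hdom.mono' hcont.aestronglyMeasurable ?_
      refine (ae_restrict_iff' measurableSet_Ioi).2 (Eventually.of_forall fun x hx => ?_)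
      have hx0 : 0 < x := hx
      rw [Real.norm_eq_abs, abs_div, abs_mul, Real.abs_exp, abs_of_pos (by positivity : (0:ℝ) < 1 + x ^ 2)]
      rw [div_le_iff₀ (by positivity), show -(x * T) = -T * x by ring]
      have h1 : |x * Real.sin T + Real.cos T| ≤ x + 1 := by
        refine (abs_add_le _ _).trans (add_le_add ?_ (Real.abs_cos_le_one T))
        rw [abs_mul, abs_of_pos hx0]
        exact mul_le_of_le_one_right hx0.le (Real.abs_sin_le_one T)
      have h2 : x + 1 ≤ 2 * (1 + x ^ 2) := by nlinarith [sq_nonneg (x - 1)]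
      calc Real.exp (-T * x) * |x * Real.sin T + Real.cos T|
          ≤ Real.exp (-T * x) * (2 * (1 + x ^ 2)) :=
            mul_le_mul_of_nonneg_left (h1.trans h2) (Real.exp_pos _).le
        _ = 2 * Real.exp (-T * x) * (1 + x ^ 2) := by ring
  rw [integral_sub (integrable_inv_one_add_sq.integrableOn) htail, integral_Ioi_inv_one_add_sq,
    Real.arctan_zero, sub_zero]

/-- The tail is `O(1/T)`: `|∫_0^∞ e^{-xT}(x sin T + cos T)/(1+x²) dx| ≤ 2/T` for `T > 0`. [folklore] -/
private theorem abs_dirichlet_tail_le {T : ℝ} (hT : 0 < T) :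
    |∫ x in Ioi (0 : ℝ), Real.exp (-(x * T)) * (x * Real.sin T + Real.cos T) / (1 + x ^ 2)| ≤ 2 / T := by
  have hdom : IntegrableOn (fun x : ℝ => 2 * Real.exp (-T * x)) (Ioi 0) :=
    (exp_neg_integrableOn_Ioi 0 hT).const_mul 2
  have hval : ∫ x in Ioi (0 : ℝ), 2 * Real.exp (-T * x) = 2 / T := by
    rw [integral_const_mul, integral_exp_mul_Ioi (by linarith) 0]
    simp only [mul_zero, Real.exp_zero]
    field_simp
  rw [← Real.norm_eq_abs, ← hval]
  refine norm_integral_le_of_norm_le hdom ?_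
  refine (ae_restrict_iff' measurableSet_Ioi).2 (Eventually.of_forall fun x hx => ?_)
  have hx0 : 0 < x := hx
  rw [Real.norm_eq_abs, abs_div, abs_mul, Real.abs_exp, abs_of_pos (by positivity : (0:ℝ) < 1 + x ^ 2)]
  rw [div_le_iff₀ (by positivity), show -(x * T) = -T * x by ring]
  have h1 : |x * Real.sin T + Real.cos T| ≤ x + 1 := by
    refine (abs_add_le _ _).trans (add_le_add ?_ (Real.abs_cos_le_one T))
    rw [abs_mul, abs_of_pos hx0]
    exact mul_le_of_le_one_right hx0.le (Real.abs_sin_le_one T)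
  have h2 : x + 1 ≤ 2 * (1 + x ^ 2) := by nlinarith [sq_nonneg (x - 1)]
  calc Real.exp (-T * x) * |x * Real.sin T + Real.cos T|
      ≤ Real.exp (-T * x) * (2 * (1 + x ^ 2)) :=
        mul_le_mul_of_nonneg_left (h1.trans h2) (Real.exp_pos _).le
    _ = 2 * Real.exp (-T * x) * (1 + x ^ 2) := by ring

/-- **The Dirichlet integral**, `lim_{T→∞} ∫_0^T sin u/u du = π/2`. [folklore] -/
private theorem tendsto_intervalIntegral_sin_div :
    Tendsto (fun T : ℝ => ∫ u in (0 : ℝ)..T, Real.sin u / u) atTop (𝓝 (Real.pi / 2)) := by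
  have hev : (fun T : ℝ => Real.pi / 2 -
      ∫ x in Ioi (0 : ℝ), Real.exp (-(x * T)) * (x * Real.sin T + Real.cos T) / (1 + x ^ 2)) =ᶠ[atTop]
      fun T : ℝ => ∫ u in (0 : ℝ)..T, Real.sin u / u := by
    filter_upwards [eventually_ge_atTop (0 : ℝ)] with T hT
    rw [intervalIntegral_sin_div_eq T hT]
  refine Tendsto.congr' hev ?_
  rw [show (𝓝 (Real.pi / 2)) = 𝓝 (Real.pi / 2 - 0) by rw [sub_zero]]
  refine tendsto_const_nhds.sub ?_
  have h2T : Tendsto (fun T : ℝ => 2 / T) atTop (𝓝 0) :=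
    tendsto_const_nhds.div_atTop tendsto_id
  refine squeeze_zero_norm' ?_ h2T
  filter_upwards [eventually_gt_atTop (0 : ℝ)] with T hT
  rw [Real.norm_eq_abs]
  exact abs_dirichlet_tail_le hT

/-- Scaling: `∫_0^T sin(au)/u du = ∫_0^{aT} sin v/v dv` (`a ≠ 0`). [folklore] -/
private theorem intervalIntegral_sin_mul_div (a T : ℝ) (ha : a ≠ 0) :
    ∫ u in (0 : ℝ)..T, Real.sin (a * u) / u = ∫ v in (0 : ℝ)..a * T, Real.sin v / v := by
  have h : (fun u : ℝ => Real.sin (a * u) / u) = fun u : ℝ => a * (Real.sin (a * u) / (a * u)) := by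
    funext u
    rcases eq_or_ne u 0 with rfl | hu
    · simp
    · field_simp
  rw [h, intervalIntegral.integral_const_mul, ← smul_eq_mul,
    intervalIntegral.smul_integral_comp_mul_left (f := fun v : ℝ => Real.sin v / v), mul_zero]

/-- **(3.3.1.1) for every real `a`**: `lim_{T→∞} ∫_0^T sin(au)/u du = π/2` (`a > 0`), `= -π/2` (`a < 0`) —
the Dirichlet integral, proved by the Laplace-transform/Fubini argument (`1/u = ∫_0^∞ e^{-xu} dx`,
`∫_0^T e^{-xu} sin u du` in closed form, `∫_0^∞ dx/(1+x²) = π/2`, tail `≤ 2/T`) and the scaling `u ↦ au`.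
Discharge of the named fact `DirichletIntegral`. [cite: DavisRabinowitz1984, Sect. 3.3.1 (3.3.1.1)] -/
theorem DirichletIntegral_holds : ∀ a : ℝ, DirichletIntegral a := by
  intro a
  refine ⟨fun ha => ?_, fun ha => ?_⟩
  · have h := tendsto_intervalIntegral_sin_div.comp (Tendsto.const_mul_atTop ha tendsto_id)
    refine (h.congr fun T => ?_)
    simp only [Function.comp_apply, id_eq]
    rw [intervalIntegral_sin_mul_div a T ha.ne']
  · have hneg : 0 < -a := by linarith
    have h := tendsto_intervalIntegral_sin_div.comp (Tendsto.const_mul_atTop hneg tendsto_id)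
    have h' := h.neg
    refine (h'.congr fun T => ?_)
    simp only [Function.comp_apply, id_eq]
    rw [← intervalIntegral_sin_mul_div (-a) T hneg.ne', ← intervalIntegral.integral_neg]
    congr 1
    funext u
    rw [neg_mul, Real.sin_neg, neg_div, neg_neg]

end DirichletIntegralProof

section RiceCosExpIntegralProof

/-- `|cos u - e^{-u}| ≤ 2u` for `u ≥ 0`. [folklore] -/
private theorem abs_cos_sub_exp_neg_le {u : ℝ} (hu : 0 ≤ u) : |Real.cos u - Real.exp (-u)| ≤ 2 * u := by
  have h1 : |Real.cos u - 1| ≤ u := by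
    rw [abs_sub_comm, abs_of_nonneg (by linarith [Real.cos_le_one u])]
    have hc := Real.one_sub_sq_div_two_le_cos (x := u)
    rcases le_or_gt u 2 with h2 | h2
    · nlinarith
    · linarith [Real.neg_one_le_cos u]
  have h2 : |1 - Real.exp (-u)| ≤ u := by
    rw [abs_of_nonneg (by
      have := Real.exp_le_one_iff.2 (neg_nonpos.2 hu)
      linarith)]
    have := Real.add_one_le_exp (-u)
    linarith
  calc |Real.cos u - Real.exp (-u)| = |(Real.cos u - 1) + (1 - Real.exp (-u))| := by ring_nf
    _ ≤ |Real.cos u - 1| + |1 - Real.exp (-u)| := abs_add_le _ _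
    _ ≤ 2 * u := by linarith

/-- `∫_0^T e^{-xu} cos u du = (x + e^{-xT}(sin T - x cos T))/(1+x²)`. [folklore] -/
private theorem intervalIntegral_exp_neg_mul_cos (x T : ℝ) :
    ∫ u in (0 : ℝ)..T, Real.exp (-(x * u)) * Real.cos u =
      (x + Real.exp (-(x * T)) * (Real.sin T - x * Real.cos T)) / (1 + x ^ 2) := by
  have hx : (1 + x ^ 2) ≠ 0 := by positivity
  have hderiv : ∀ u : ℝ, HasDerivAt
      (fun u : ℝ => Real.exp (-(x * u)) * (Real.sin u - x * Real.cos u) / (1 + x ^ 2))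
      (Real.exp (-(x * u)) * Real.cos u) u := by
    intro u
    have h2 : HasDerivAt (fun u : ℝ => Real.exp (-(x * u))) (Real.exp (-(x * u)) * -x) u :=
      (Real.hasDerivAt_exp _).comp u (hasDerivAt_neg_const_mul x u)
    have h3 : HasDerivAt (fun u : ℝ => Real.sin u - x * Real.cos u) (Real.cos u - x * -Real.sin u) u :=
      (Real.hasDerivAt_sin u).sub ((Real.hasDerivAt_cos u).const_mul x)
    have h4 : HasDerivAt (fun u : ℝ => Real.exp (-(x * u)) * (Real.sin u - x * Real.cos u) / (1 + x ^ 2))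
        ((Real.exp (-(x * u)) * -x * (Real.sin u - x * Real.cos u) +
          Real.exp (-(x * u)) * (Real.cos u - x * -Real.sin u)) / (1 + x ^ 2)) u :=
      (h2.mul h3).div_const (1 + x ^ 2)
    refine h4.congr_deriv ?_
    field_simp
    ring
  rw [intervalIntegral.integral_eq_sub_of_hasDerivAt (fun u _ => hderiv u)
    ((by fun_prop : Continuous fun u : ℝ => Real.exp (-(x * u)) * Real.cos u).intervalIntegrable _ _)]
  simp only [mul_zero, neg_zero, Real.exp_zero, Real.sin_zero, Real.cos_zero, one_mul, mul_one, zero_sub]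
  field_simp
  ring

/-- `∫_0^T e^{-xu} e^{-u} du = (1 - e^{-(x+1)T})/(x+1)` for `x + 1 ≠ 0`. [folklore] -/
private theorem intervalIntegral_exp_neg_mul_exp_neg {x : ℝ} (hx : x + 1 ≠ 0) (T : ℝ) :
    ∫ u in (0 : ℝ)..T, Real.exp (-(x * u)) * Real.exp (-u) = (1 - Real.exp (-((x + 1) * T))) / (x + 1) := by
  have hderiv : ∀ u : ℝ, HasDerivAt (fun u : ℝ => -Real.exp (-((x + 1) * u)) / (x + 1))
      (Real.exp (-(x * u)) * Real.exp (-u)) u := by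
    intro u
    have h2 : HasDerivAt (fun u : ℝ => Real.exp (-((x + 1) * u))) (Real.exp (-((x + 1) * u)) * -(x + 1)) u :=
      (Real.hasDerivAt_exp _).comp u (hasDerivAt_neg_const_mul (x + 1) u)
    have h4 : HasDerivAt (fun u : ℝ => -Real.exp (-((x + 1) * u)) / (x + 1))
        (-(Real.exp (-((x + 1) * u)) * -(x + 1)) / (x + 1)) u := h2.neg.div_const (x + 1)
    refine h4.congr_deriv ?_
    rw [← Real.exp_add]
    field_simp
    ring_nf
  rw [intervalIntegral.integral_eq_sub_of_hasDerivAt (fun u _ => hderiv u)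
    ((by fun_prop : Continuous fun u : ℝ => Real.exp (-(x * u)) * Real.exp (-u)).intervalIntegrable _ _)]
  simp only [mul_zero, neg_zero, Real.exp_zero]
  field_simp
  ring

/-- The "main term" vanishes: `∫_0^∞ (x/(1+x²) - 1/(x+1)) dx = 0` (antiderivative `½ log(1+x²) - log(1+x)`,
which tends to `log 1 = 0`). [folklore] -/
private theorem integral_Ioi_main_term :
    ∫ x in Ioi (0 : ℝ), (x / (1 + x ^ 2) - 1 / (x + 1)) = 0 := by
  have hderiv : ∀ x ∈ Ioi (0 : ℝ), HasDerivAt (fun x : ℝ => Real.log (1 + x ^ 2) / 2 - Real.log (x + 1))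
      (x / (1 + x ^ 2) - 1 / (x + 1)) x := by
    intro x hx
    have hx0 : 0 < x := hx
    have h1 : HasDerivAt (fun x : ℝ => 1 + x ^ 2) (2 * x) x := by
      simpa using (hasDerivAt_pow 2 x).const_add 1
    have h2 : HasDerivAt (fun x : ℝ => Real.log (1 + x ^ 2)) ((2 * x) / (1 + x ^ 2)) x :=
      h1.log (by positivity)
    have h3 : HasDerivAt (fun x : ℝ => x + 1) 1 x := (hasDerivAt_id x).add_const 1
    have h4 : HasDerivAt (fun x : ℝ => Real.log (x + 1)) (1 / (x + 1)) x := h3.log (by linarith)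
    have h5 := (h2.div_const 2).sub h4
    refine h5.congr_deriv ?_
    field_simp
  have hint : IntegrableOn (fun x : ℝ => x / (1 + x ^ 2) - 1 / (x + 1)) (Ioi 0) := by
    refine (integrable_inv_one_add_sq.integrableOn (s := Ioi (0 : ℝ))).mono' ?_ ?_
    · exact (continuous_div_one_add_sq.continuousOn.sub
        (continuousOn_const.div (by fun_prop) fun x hx => by
          have : (0 : ℝ) < x := hx; linarith)).aestronglyMeasurable measurableSet_Ioi
    · refine (ae_restrict_iff' measurableSet_Ioi).2 (Eventually.of_forall fun x hx => ?_)
      have hx0 : 0 < x := hx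
      have hx1 : (0 : ℝ) < x + 1 := by linarith
      rw [Real.norm_eq_abs, show x / (1 + x ^ 2) - 1 / (x + 1) = (x - 1) / ((1 + x ^ 2) * (x + 1)) by
        field_simp; ring, abs_div, abs_of_pos (by positivity : (0 : ℝ) < (1 + x ^ 2) * (x + 1)),
        div_le_iff₀ (by positivity)]
      have : |x - 1| ≤ x + 1 := abs_sub_le_iff.2 ⟨by linarith, by linarith⟩
      calc |x - 1| ≤ x + 1 := this
        _ = (1 + x ^ 2)⁻¹ * ((1 + x ^ 2) * (x + 1)) := by field_simp
  have hlim : Tendsto (fun x : ℝ => Real.log (1 + x ^ 2) / 2 - Real.log (x + 1)) atTop (𝓝 0) := by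
    -- `= ½ log((1+x²)/(x+1)²)` for `x > 0`, and `(1+x²)/(x+1)² → 1`
    have hratio : Tendsto (fun x : ℝ => (1 + x ^ 2) / (x + 1) ^ 2) atTop (𝓝 1) := by
      have hev : (fun x : ℝ => 1 - 2 * x / (x + 1) ^ 2) =ᶠ[atTop] fun x : ℝ => (1 + x ^ 2) / (x + 1) ^ 2 := by
        filter_upwards [eventually_gt_atTop (0 : ℝ)] with x hx
        have : (x + 1) ^ 2 ≠ 0 := by positivity
        field_simp
        ring
      refine Tendsto.congr' hev ?_
      rw [show (𝓝 (1 : ℝ)) = 𝓝 (1 - 0) by rw [sub_zero]]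
      refine tendsto_const_nhds.sub ?_
      have h2x : Tendsto (fun x : ℝ => 2 / x) atTop (𝓝 0) := tendsto_const_nhds.div_atTop tendsto_id
      refine squeeze_zero' ?_ ?_ h2x
      · filter_upwards [eventually_gt_atTop (0 : ℝ)] with x hx
        positivity
      · filter_upwards [eventually_gt_atTop (0 : ℝ)] with x hx
        rw [div_le_div_iff₀ (by positivity) hx]
        nlinarith
    have hlog := hratio.log one_ne_zero
    rw [Real.log_one] at hlog
    have hev : (fun x : ℝ => Real.log ((1 + x ^ 2) / (x + 1) ^ 2) / 2) =ᶠ[atTop]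
        fun x : ℝ => Real.log (1 + x ^ 2) / 2 - Real.log (x + 1) := by
      filter_upwards [eventually_gt_atTop (0 : ℝ)] with x hx
      rw [Real.log_div (by positivity) (by positivity), Real.log_pow]
      push_cast
      ring
    refine Tendsto.congr' hev ?_
    simpa using hlog.div_const 2
  have hcont : ContinuousWithinAt (fun x : ℝ => Real.log (1 + x ^ 2) / 2 - Real.log (x + 1)) (Ici 0) 0 := by
    refine ContinuousAt.continuousWithinAt ?_
    refine ((Real.continuousAt_log (by norm_num)).comp
        (by fun_prop : Continuous fun x : ℝ => 1 + x ^ 2).continuousAt |>.div_const 2).sub ?_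
    exact (Real.continuousAt_log (by norm_num)).comp (by fun_prop : Continuous fun x : ℝ => x + 1).continuousAt
  rw [integral_Ioi_of_hasDerivAt_of_tendsto hcont hderiv hint hlim]
  simp

/-- For `T > 0`: `∫_0^T (cos u - e^{-u})/u du = ∫_0^∞ [e^{-xT}(sin T - x cos T)/(1+x²) + e^{-(x+1)T}/(x+1)] dx`
(Laplace representation, the two inner integrals in closed form, and the vanishing main term), together
with the bound `3/T` on the right-hand side. [folklore] -/
private theorem abs_intervalIntegral_cos_sub_exp_div_le {T : ℝ} (hT : 0 < T) :
    |∫ u in (0 : ℝ)..T, (Real.cos u - Real.exp (-u)) / u| ≤ 3 / T := by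
  have hrep := intervalIntegral_div_eq_integral_laplace (φ := fun u => Real.cos u - Real.exp (-u))
    (by fun_prop) (C := 2) (fun u hu => abs_cos_sub_exp_neg_le hu) hT.le
  rw [hrep]
  -- evaluate the inner integrals on `Ioi 0`
  have hinner : ∀ x ∈ Ioi (0 : ℝ), ∫ u in (0 : ℝ)..T, Real.exp (-(x * u)) * (Real.cos u - Real.exp (-u)) =
      (x / (1 + x ^ 2) - 1 / (x + 1)) +
        (Real.exp (-(x * T)) * (Real.sin T - x * Real.cos T) / (1 + x ^ 2) +
          Real.exp (-((x + 1) * T)) / (x + 1)) := by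
    intro x hx
    have hx0 : 0 < x := hx
    have hx1 : x + 1 ≠ 0 := by linarith
    simp_rw [mul_sub]
    rw [intervalIntegral.integral_sub
      ((by fun_prop : Continuous fun u : ℝ => Real.exp (-(x * u)) * Real.cos u).intervalIntegrable _ _)
      ((by fun_prop : Continuous fun u : ℝ => Real.exp (-(x * u)) * Real.exp (-u)).intervalIntegrable _ _),
      intervalIntegral_exp_neg_mul_cos, intervalIntegral_exp_neg_mul_exp_neg hx1]
    have : (1 + x ^ 2) ≠ 0 := by positivity
    field_simp
    ring
  rw [setIntegral_congr_fun measurableSet_Ioi hinner]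
  -- the tail is dominated by `3 e^{-Tx}`
  have hdom : IntegrableOn (fun x : ℝ => 3 * Real.exp (-T * x)) (Ioi 0) :=
    (exp_neg_integrableOn_Ioi 0 hT).const_mul 3
  have hval : ∫ x in Ioi (0 : ℝ), 3 * Real.exp (-T * x) = 3 / T := by
    rw [integral_const_mul, integral_exp_mul_Ioi (by linarith) 0]
    simp only [mul_zero, Real.exp_zero]
    field_simp
  have htail_bound : ∀ x ∈ Ioi (0 : ℝ), ‖Real.exp (-(x * T)) * (Real.sin T - x * Real.cos T) / (1 + x ^ 2) +
      Real.exp (-((x + 1) * T)) / (x + 1)‖ ≤ 3 * Real.exp (-T * x) := by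
    intro x hx
    have hx0 : 0 < x := hx
    have hx1 : (0 : ℝ) < x + 1 := by linarith
    rw [Real.norm_eq_abs]
    refine (abs_add_le _ _).trans ?_
    have h1 : |Real.exp (-(x * T)) * (Real.sin T - x * Real.cos T) / (1 + x ^ 2)| ≤ 2 * Real.exp (-T * x) := by
      rw [abs_div, abs_mul, Real.abs_exp, abs_of_pos (by positivity : (0:ℝ) < 1 + x ^ 2),
        div_le_iff₀ (by positivity), show -(x * T) = -T * x by ring]
      have h1 : |Real.sin T - x * Real.cos T| ≤ 1 + x := by
        refine (abs_sub _ _).trans (add_le_add (Real.abs_sin_le_one T) ?_)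
        rw [abs_mul, abs_of_pos hx0]
        exact mul_le_of_le_one_right hx0.le (Real.abs_cos_le_one T)
      have h2 : 1 + x ≤ 2 * (1 + x ^ 2) := by nlinarith [sq_nonneg (x - 1)]
      calc Real.exp (-T * x) * |Real.sin T - x * Real.cos T|
          ≤ Real.exp (-T * x) * (2 * (1 + x ^ 2)) :=
            mul_le_mul_of_nonneg_left (h1.trans h2) (Real.exp_pos _).le
        _ = 2 * Real.exp (-T * x) * (1 + x ^ 2) := by ring
    have h2 : |Real.exp (-((x + 1) * T)) / (x + 1)| ≤ Real.exp (-T * x) := by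
      rw [abs_div, Real.abs_exp, abs_of_pos hx1, div_le_iff₀ hx1]
      have h3 : Real.exp (-((x + 1) * T)) ≤ Real.exp (-T * x) :=
        Real.exp_le_exp.2 (by nlinarith)
      have h4 : Real.exp (-T * x) ≤ Real.exp (-T * x) * (x + 1) :=
        le_mul_of_one_le_right (Real.exp_pos _).le (by linarith)
      exact h3.trans h4
    linarith
  have htail : IntegrableOn (fun x : ℝ => Real.exp (-(x * T)) * (Real.sin T - x * Real.cos T) / (1 + x ^ 2) +
      Real.exp (-((x + 1) * T)) / (x + 1)) (Ioi 0) := by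
    refine hdom.mono' ?_ ((ae_restrict_iff' measurableSet_Ioi).2 (Eventually.of_forall htail_bound))
    refine ContinuousOn.aestronglyMeasurable ?_ measurableSet_Ioi
    refine (((by fun_prop : Continuous fun x : ℝ => Real.exp (-(x * T)) * (Real.sin T - x * Real.cos T)).div
        (by fun_prop) fun x => by positivity).continuousOn).add ?_
    · exact (by fun_prop : Continuous fun x : ℝ => Real.exp (-((x + 1) * T))).continuousOn.div
        (by fun_prop) fun x hx => by have : (0 : ℝ) < x := hx; linarith
  have hmain : IntegrableOn (fun x : ℝ => x / (1 + x ^ 2) - 1 / (x + 1)) (Ioi 0) := by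
    -- as in `integral_Ioi_main_term`
    refine (integrable_inv_one_add_sq.integrableOn (s := Ioi (0 : ℝ))).mono' ?_ ?_
    · exact (continuous_div_one_add_sq.continuousOn.sub
        (continuousOn_const.div (by fun_prop) fun x hx => by
          have : (0 : ℝ) < x := hx; linarith)).aestronglyMeasurable measurableSet_Ioi
    · refine (ae_restrict_iff' measurableSet_Ioi).2 (Eventually.of_forall fun x hx => ?_)
      have hx0 : 0 < x := hx
      have hx1 : (0 : ℝ) < x + 1 := by linarith
      rw [Real.norm_eq_abs, show x / (1 + x ^ 2) - 1 / (x + 1) = (x - 1) / ((1 + x ^ 2) * (x + 1)) by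
        field_simp; ring, abs_div, abs_of_pos (by positivity : (0 : ℝ) < (1 + x ^ 2) * (x + 1)),
        div_le_iff₀ (by positivity)]
      have : |x - 1| ≤ x + 1 := abs_sub_le_iff.2 ⟨by linarith, by linarith⟩
      calc |x - 1| ≤ x + 1 := this
        _ = (1 + x ^ 2)⁻¹ * ((1 + x ^ 2) * (x + 1)) := by field_simp
  rw [integral_add hmain htail, integral_Ioi_main_term, zero_add, ← Real.norm_eq_abs, ← hval]
  exact norm_integral_le_of_norm_le hdom ((ae_restrict_iff' measurableSet_Ioi).2
    (Eventually.of_forall htail_bound))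

/-- `lim_{T→∞} ∫_0^T (cos u - e^{-u})/u du = 0`. [folklore] -/
private theorem tendsto_intervalIntegral_cos_sub_exp_div :
    Tendsto (fun T : ℝ => ∫ u in (0 : ℝ)..T, (Real.cos u - Real.exp (-u)) / u) atTop (𝓝 0) := by
  have h3T : Tendsto (fun T : ℝ => 3 / T) atTop (𝓝 0) := tendsto_const_nhds.div_atTop tendsto_id
  refine squeeze_zero_norm' ?_ h3T
  filter_upwards [eventually_gt_atTop (0 : ℝ)] with T hT
  rw [Real.norm_eq_abs]
  exact abs_intervalIntegral_cos_sub_exp_div_le hT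

/-- **(3.3.1.2) for every `a > 0`**: `lim_{T→∞} ∫_0^T [cos(au) - e^{-au}]/u du = 0`, by the same
Laplace-transform/Fubini argument (inner integrals `∫_0^T e^{-xu} cos u du`, `∫_0^T e^{-(x+1)u} du` in
closed form, main term `∫_0^∞ (x/(1+x²) - 1/(x+1)) dx = 0`, tail `≤ 3/T`) and the scaling `u ↦ au`.
Discharge of the named fact `RiceCosExpIntegral`. [cite: DavisRabinowitz1984, Sect. 3.3.1 (3.3.1.2)] -/
theorem RiceCosExpIntegral_holds : ∀ a : ℝ, RiceCosExpIntegral a := by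
  intro a ha
  have hscale : ∀ T : ℝ, ∫ u in (0 : ℝ)..T, (Real.cos (a * u) - Real.exp (-(a * u))) / u =
      ∫ v in (0 : ℝ)..a * T, (Real.cos v - Real.exp (-v)) / v := by
    intro T
    have h : (fun u : ℝ => (Real.cos (a * u) - Real.exp (-(a * u))) / u) =
        fun u : ℝ => a * ((Real.cos (a * u) - Real.exp (-(a * u))) / (a * u)) := by
      funext u
      rcases eq_or_ne u 0 with rfl | hu
      · simp
      · field_simp
    rw [h, intervalIntegral.integral_const_mul, ← smul_eq_mul,
      intervalIntegral.smul_integral_comp_mul_left (f := fun v : ℝ => (Real.cos v - Real.exp (-v)) / v),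
      mul_zero]
  have h := tendsto_intervalIntegral_cos_sub_exp_div.comp (Tendsto.const_mul_atTop ha tendsto_id)
  refine h.congr fun T => ?_
  simp only [Function.comp_apply, id_eq]
  rw [hscale]

end RiceCosExpIntegralProof

/-! ## Proof of (3.3.1.5) for every `n ≥ 1` (`RiceLogIntegral_holds`)

Write `(e^{-αu} - e^{-βu})^n = Σ_k (-1)^k C(n,k) e^{-λ_k u}` with `λ_k = (n-k)α + kβ > 0`, and let `φ_j` be its
`j`-th derivative `Σ_k (-1)^k C(n,k) (-λ_k)^j e^{-λ_k u}`. The moments `Σ_k (-1)^k C(n,k) λ_k^j`, `j < n`,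
vanish (an `n`-th forward difference of the polynomial `(nα + X(β-α))^j` of degree `< n`; Mathlib's
`Polynomial.fwdDiff_iter_eq_zero_of_degree_lt`), i.e. `φ_j(0) = 0` for `j < n`, whence `|φ_j(u)| ≤ A u^{n-j}`
near `0`; together with the exponential decay `|φ_j(u)| ≤ A_j e^{-μu}` this makes every
`φ_j(u) u^{-(n-j)}` integrable on `(0, ∞)` and kills all boundary terms in the `n - 1` integrations by
parts `∫_0^∞ φ_j u^{-(n-j)} = (n-j-1)⁻¹ ∫_0^∞ φ_{j+1} u^{-(n-j-1)}`
(`MeasureTheory.integral_Ioi_mul_deriv_eq_deriv_mul`).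
The last integral `∫_0^∞ φ_{n-1}(u)/u du` is a generalised Frullani integral: since `Σ_k w_k = φ_{n-1}(0) = 0`
it equals `Σ_k w_k ∫_0^∞ (e^{-λ_k u} - e^{-u})/u du = -Σ_k w_k log λ_k`, the exponential Frullani integral
`∫_0^∞ (e^{-pu} - e^{-qu})/u du = log q - log p` being obtained by Fubini from `∫_0^∞ e^{-tu} du = 1/t`.
-/

section RiceLogIntegralProof

/-- The exponents `λ_k = (n-k)α + kβ` of the expansion of `(e^{-αu} - e^{-βu})^n`. [folklore] -/
private noncomputable def rlam (n : ℕ) (α β : ℝ) (k : ℕ) : ℝ := ((n : ℝ) - k) * α + k * β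

/-- `φ_j(u) = Σ_k (-1)^k C(n,k) (-λ_k)^j e^{-λ_k u}`, the `j`-th derivative of `(e^{-αu} - e^{-βu})^n`.
[folklore] -/
private noncomputable def rphi (n : ℕ) (α β : ℝ) (j : ℕ) (u : ℝ) : ℝ :=
  ∑ k ∈ Finset.range (n + 1),
    (-1 : ℝ) ^ k * (n.choose k : ℝ) * (-rlam n α β k) ^ j * Real.exp (-(rlam n α β k * u))

/-- The constants `A_j = Σ_k C(n,k) λ_k^j` bounding `φ_j`. [folklore] -/
private noncomputable def rA (n : ℕ) (α β : ℝ) (j : ℕ) : ℝ :=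
  ∑ k ∈ Finset.range (n + 1), (n.choose k : ℝ) * rlam n α β k ^ j

/-- `λ_k = nα + k(β - α)`. [folklore] -/
private theorem rlam_eq (n : ℕ) (α β : ℝ) (k : ℕ) : rlam n α β k = n * α + k * (β - α) := by
  unfold rlam; ring

/-- `λ_k ≥ min(α, β) > 0` for `k ≤ n`, `n ≥ 1`. [folklore] -/
private theorem min_le_rlam {n : ℕ} (hn : 1 ≤ n) {α β : ℝ} (hα : 0 < α) (hβ : 0 < β) {k : ℕ}
    (hk : k ≤ n) : min α β ≤ rlam n α β k := by
  unfold rlam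
  have h1 : (0 : ℝ) ≤ (n : ℝ) - k := by
    have : (k : ℝ) ≤ n := by exact_mod_cast hk
    linarith
  have h2 : (1 : ℝ) ≤ n := by exact_mod_cast hn
  have hk0 : (0 : ℝ) ≤ k := by positivity
  calc min α β = ((n : ℝ) - k) * min α β + k * min α β + (1 - n) * min α β := by ring
    _ ≤ ((n : ℝ) - k) * α + k * β + 0 := by
        refine add_le_add (add_le_add (mul_le_mul_of_nonneg_left (min_le_left _ _) h1)
          (mul_le_mul_of_nonneg_left (min_le_right _ _) hk0)) ?_
        have : 0 < min α β := lt_min hα hβ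
        nlinarith
    _ = ((n : ℝ) - k) * α + k * β := add_zero _

/-- `λ_k > 0`. [folklore] -/
private theorem rlam_pos {n : ℕ} (hn : 1 ≤ n) {α β : ℝ} (hα : 0 < α) (hβ : 0 < β) {k : ℕ}
    (hk : k ≤ n) : 0 < rlam n α β k :=
  (lt_min hα hβ).trans_le (min_le_rlam hn hα hβ hk)

/-- The binomial expansion `(e^{-αu} - e^{-βu})^n = φ_0(u)`. [folklore] -/
private theorem rphi_zero_eq (n : ℕ) (α β u : ℝ) :
    rphi n α β 0 u = (Real.exp (-(α * u)) - Real.exp (-(β * u))) ^ n := by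
  rw [sub_eq_neg_add, add_pow, rphi]
  refine Finset.sum_congr rfl fun k hk => ?_
  rw [Finset.mem_range] at hk
  have hexp : Real.exp ((k : ℕ) * -(β * u)) * Real.exp ((n - k : ℕ) * -(α * u)) =
      Real.exp (-(rlam n α β k * u)) := by
    rw [← Real.exp_add, rlam]
    congr 1
    push_cast [Nat.cast_sub (by omega : k ≤ n)]
    ring
  rw [pow_zero, mul_one, neg_pow (Real.exp _) k, ← Real.exp_nat_mul, ← Real.exp_nat_mul, ← hexp]
  ring

/-- `φ_j' = φ_{j+1}`. [folklore] -/
private theorem hasDerivAt_rphi (n : ℕ) (α β : ℝ) (j : ℕ) (u : ℝ) :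
    HasDerivAt (rphi n α β j) (rphi n α β (j + 1) u) u := by
  unfold rphi
  refine HasDerivAt.fun_sum fun k _ => ?_
  have h1 : HasDerivAt (fun u : ℝ => -(rlam n α β k * u)) (-rlam n α β k) u := by
    have h := (hasDerivAt_id u).const_mul (-rlam n α β k)
    simpa [neg_mul] using h
  have h2 := ((Real.hasDerivAt_exp _).comp u h1).const_mul
    ((-1 : ℝ) ^ k * (n.choose k : ℝ) * (-rlam n α β k) ^ j)
  refine h2.congr_deriv ?_
  rw [pow_succ]
  ring

/-- `φ_j` is continuous. [folklore] -/
private theorem continuous_rphi (n : ℕ) (α β : ℝ) (j : ℕ) : Continuous (rphi n α β j) := by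
  unfold rphi
  fun_prop

/-- The vanishing moments: `Σ_k (-1)^k C(n,k) λ_k^j = 0` for `j < n` (an `n`-th forward difference of a
polynomial of degree `j < n`), i.e. `φ_j(0) = 0`. [folklore] -/
private theorem rphi_at_zero {n : ℕ} (α β : ℝ) {j : ℕ} (hj : j < n) : rphi n α β j 0 = 0 := by
  -- the polynomial `P(X) = (nα + X(β - α))^j`, `P(k) = λ_k^j`
  set P : Polynomial ℝ := (Polynomial.C (β - α) * Polynomial.X + Polynomial.C ((n : ℝ) * α)) ^ j
    with hP
  have hdeg : P.natDegree < n := by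
    refine lt_of_le_of_lt ?_ hj
    rw [hP]
    refine (Polynomial.natDegree_pow_le).trans ?_
    calc j * (Polynomial.C (β - α) * Polynomial.X + Polynomial.C ((n : ℝ) * α)).natDegree ≤ j * 1 :=
          Nat.mul_le_mul_left j Polynomial.natDegree_linear_le
      _ = j := mul_one j
  have heval : ∀ k : ℕ, P.eval (k : ℝ) = rlam n α β k ^ j := by
    intro k
    rw [hP, Polynomial.eval_pow, Polynomial.eval_add, Polynomial.eval_mul, Polynomial.eval_C,
      Polynomial.eval_X, Polynomial.eval_C, rlam_eq]
    ring
  have hfd := congrFun (Polynomial.fwdDiff_iter_eq_zero_of_degree_lt hdeg) 0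
  rw [fwdDiff_iter_eq_sum_shift, Pi.zero_apply] at hfd
  -- `hfd : Σ_k ((-1)^(n-k) C(n,k) : ℤ) • P.eval (0 + k • 1) = 0`
  have hsum : ∑ k ∈ Finset.range (n + 1), (-1 : ℝ) ^ (n - k) * (n.choose k : ℝ) * rlam n α β k ^ j = 0 := by
    rw [← hfd]
    refine Finset.sum_congr rfl fun k _ => ?_
    rw [zsmul_eq_mul, zero_add, nsmul_eq_mul, mul_one, heval]
    push_cast
    ring
  unfold rphi
  simp only [mul_zero, neg_zero, Real.exp_zero, mul_one]
  have hrw : ∀ k ∈ Finset.range (n + 1), (-1 : ℝ) ^ k * (n.choose k : ℝ) * (-rlam n α β k) ^ j =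
      (-1 : ℝ) ^ (n + j) * ((-1 : ℝ) ^ (n - k) * (n.choose k : ℝ) * rlam n α β k ^ j) := by
    intro k hk
    rw [Finset.mem_range] at hk
    rw [neg_pow, show (-1 : ℝ) ^ (n + j) = (-1) ^ (n - k) * (-1) ^ k * (-1) ^ j by
      rw [← pow_add, ← pow_add]; congr 1; omega]
    have : ((-1 : ℝ) ^ (n - k)) ^ 2 = 1 := by rw [← pow_mul, mul_comm, pow_mul]; norm_num
    linear_combination (-((-1 : ℝ) ^ k * (n.choose k : ℝ) * (-1) ^ j * rlam n α β k ^ j)) * this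
  rw [Finset.sum_congr rfl hrw, ← Finset.mul_sum, hsum, mul_zero]

/-- Exponential bound: `|φ_j(u)| ≤ A_j e^{-μu}` for `u ≥ 0`, `μ = min(α, β)`. [folklore] -/
private theorem abs_rphi_le {n : ℕ} (hn : 1 ≤ n) {α β : ℝ} (hα : 0 < α) (hβ : 0 < β) (j : ℕ) {u : ℝ}
    (hu : 0 ≤ u) : |rphi n α β j u| ≤ rA n α β j * Real.exp (-(min α β * u)) := by
  unfold rphi rA
  rw [Finset.sum_mul]
  refine (Finset.abs_sum_le_sum_abs _ _).trans (Finset.sum_le_sum fun k hk => ?_)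
  rw [Finset.mem_range] at hk
  have hk' : k ≤ n := by omega
  have hl := rlam_pos hn hα hβ hk'
  rw [abs_mul, abs_mul, abs_mul, abs_pow, abs_pow, abs_neg, abs_neg, abs_one, one_pow, one_mul,
    Nat.abs_cast, abs_of_pos hl, Real.abs_exp]
  refine mul_le_mul_of_nonneg_left (Real.exp_le_exp.2 ?_) (by positivity)
  have := min_le_rlam hn hα hβ hk'
  nlinarith

/-- `A_j ≥ 0`. [folklore] -/
private theorem rA_nonneg {n : ℕ} (hn : 1 ≤ n) {α β : ℝ} (hα : 0 < α) (hβ : 0 < β) (j : ℕ) :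
    0 ≤ rA n α β j := by
  unfold rA
  refine Finset.sum_nonneg fun k hk => ?_
  rw [Finset.mem_range] at hk
  have := rlam_pos hn hα hβ (by omega : k ≤ n)
  positivity

/-- Polynomial bound at `0`: `|φ_{n-m}(u)| ≤ A_n u^m` for `m ≤ n`, `u ≥ 0` (from `φ_j(0) = 0`, `j < n`, and
`φ_j' = φ_{j+1}`, by induction on `m`). [folklore] -/
private theorem abs_rphi_le_pow {n : ℕ} (hn : 1 ≤ n) {α β : ℝ} (hα : 0 < α) (hβ : 0 < β) :
    ∀ m : ℕ, m ≤ n → ∀ u : ℝ, 0 ≤ u → |rphi n α β (n - m) u| ≤ rA n α β n * u ^ m := by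
  intro m
  induction m with
  | zero =>
    intro _ u hu
    rw [Nat.sub_zero, pow_zero, mul_one]
    refine (abs_rphi_le hn hα hβ n hu).trans ?_
    refine mul_le_of_le_one_right (rA_nonneg hn hα hβ n) ?_
    rw [Real.exp_le_one_iff]
    have : 0 < min α β := lt_min hα hβ
    nlinarith
  | succ m ih =>
    intro hm u hu
    have hj : n - (m + 1) < n := by omega
    have hj1 : n - (m + 1) + 1 = n - m := by omega
    -- `φ_j(u) = ∫_0^u φ_{j+1}`
    have hder : ∀ t : ℝ, HasDerivAt (rphi n α β (n - (m + 1))) (rphi n α β (n - m) t) t := by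
      intro t
      have h := hasDerivAt_rphi n α β (n - (m + 1)) t
      rwa [hj1] at h
    have hftc : rphi n α β (n - (m + 1)) u = ∫ t in (0 : ℝ)..u, rphi n α β (n - m) t := by
      rw [intervalIntegral.integral_eq_sub_of_hasDerivAt (fun t _ => hder t)
        ((continuous_rphi n α β (n - m)).intervalIntegrable 0 u), rphi_at_zero α β hj, sub_zero]
    rw [hftc]
    have hbound := intervalIntegral.norm_integral_le_of_norm_le (μ := volume) hu
      (f := fun t => rphi n α β (n - m) t) (g := fun t => rA n α β n * t ^ m)
      (Eventually.of_forall fun t ht => by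
        rw [Real.norm_eq_abs]
        exact ih (by omega) t ht.1.le)
      ((by fun_prop : Continuous fun t : ℝ => rA n α β n * t ^ m).intervalIntegrable _ _)
    rw [Real.norm_eq_abs] at hbound
    refine hbound.trans ?_
    rw [intervalIntegral.integral_const_mul, integral_pow, zero_pow (by omega), sub_zero]
    have hA := rA_nonneg hn hα hβ n
    have hum : 0 ≤ u ^ (m + 1) := by positivity
    have hm1 : (1 : ℝ) ≤ (m : ℝ) + 1 := by
      have : (0 : ℝ) ≤ m := by positivity
      linarith
    calc rA n α β n * (u ^ (m + 1) / ((m : ℝ) + 1)) ≤ rA n α β n * u ^ (m + 1) := by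
          refine mul_le_mul_of_nonneg_left (div_le_self hum hm1) hA
      _ = rA n α β n * u ^ (m + 1) := rfl

/-- Integrability of `φ_j(x) x^{-(n-j)}` on `(0, ∞)` (`j ≤ n`): bounded by `A_n` near `0` and by
`A_j e^{-μx}` for `x ≥ 1`. [folklore] -/
private theorem integrableOn_rphi_mul_inv_pow {n : ℕ} (hn : 1 ≤ n) {α β : ℝ} (hα : 0 < α) (hβ : 0 < β)
    {j : ℕ} (hj : j ≤ n) :
    IntegrableOn (fun x : ℝ => rphi n α β j x * (x ^ (n - j))⁻¹) (Ioi 0) := by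
  set μ : ℝ := min α β with hμ
  have hμ0 : 0 < μ := lt_min hα hβ
  set D : ℝ := rA n α β n * Real.exp μ + rA n α β j with hD
  have hdom : IntegrableOn (fun x : ℝ => D * Real.exp (-μ * x)) (Ioi 0) :=
    (exp_neg_integrableOn_Ioi 0 hμ0).const_mul D
  refine hdom.mono' ?_ ((ae_restrict_iff' measurableSet_Ioi).2 (Eventually.of_forall fun x hx => ?_))
  · refine ContinuousOn.aestronglyMeasurable ?_ measurableSet_Ioi
    exact (continuous_rphi n α β j).continuousOn.mul
      ((continuousOn_pow _).inv₀ fun x hx => pow_ne_zero _ (ne_of_gt hx))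
  have hx0 : 0 < x := hx
  have hApos := rA_nonneg hn hα hβ n
  have hAj := rA_nonneg hn hα hβ j
  rw [norm_mul, Real.norm_eq_abs, Real.norm_eq_abs, abs_inv, abs_of_pos (pow_pos hx0 _)]
  rcases le_or_gt x 1 with hx1 | hx1
  · -- near `0`: `|φ_j(x)| ≤ A_n x^{n-j}`
    have hb := abs_rphi_le_pow hn hα hβ (n - j) (by omega) x hx0.le
    rw [show n - (n - j) = j by omega] at hb
    have hpow : 0 < x ^ (n - j) := pow_pos hx0 _
    calc |rphi n α β j x| * (x ^ (n - j))⁻¹ ≤ rA n α β n * x ^ (n - j) * (x ^ (n - j))⁻¹ :=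
          mul_le_mul_of_nonneg_right hb (by positivity)
      _ = rA n α β n := by field_simp
      _ ≤ rA n α β n * (Real.exp μ * Real.exp (-μ * x)) := by
          refine le_mul_of_one_le_right hApos ?_
          rw [← Real.exp_add]
          exact Real.one_le_exp_iff.2 (by nlinarith)
      _ ≤ D * Real.exp (-μ * x) := by
          rw [hD, add_mul, ← mul_assoc]
          have : 0 ≤ rA n α β j * Real.exp (-μ * x) := by positivity
          linarith
  · -- `x ≥ 1`: `x^{-(n-j)} ≤ 1` and `|φ_j(x)| ≤ A_j e^{-μx}`
    have hb := abs_rphi_le hn hα hβ j hx0.le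
    have hinv : (x ^ (n - j))⁻¹ ≤ 1 := inv_le_one_of_one_le₀ (one_le_pow₀ hx1.le)
    calc |rphi n α β j x| * (x ^ (n - j))⁻¹ ≤ rA n α β j * Real.exp (-(μ * x)) * 1 :=
          mul_le_mul hb hinv (by positivity) (by positivity)
      _ = rA n α β j * Real.exp (-μ * x) := by rw [mul_one, neg_mul]
      _ ≤ D * Real.exp (-μ * x) := by
          rw [hD, add_mul]
          have : 0 ≤ rA n α β n * Real.exp μ * Real.exp (-μ * x) := by positivity
          linarith

/-- One integration by parts on `(0, ∞)`: for `j + 2 ≤ n`,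
`∫_0^∞ φ_j(x) x^{-(n-j)} dx = (n-j-1)⁻¹ ∫_0^∞ φ_{j+1}(x) x^{-(n-j-1)} dx` (the boundary terms vanish:
`φ_j(x) x^{-(n-j-1)} = O(x)` at `0` and `O(e^{-μx})` at `∞`). [folklore] -/
private theorem integral_rphi_ibp {n : ℕ} (hn : 1 ≤ n) {α β : ℝ} (hα : 0 < α) (hβ : 0 < β) {j : ℕ}
    (hj : j + 2 ≤ n) :
    ∫ x in Ioi (0 : ℝ), rphi n α β j x * (x ^ (n - j))⁻¹ =
      ((n : ℝ) - j - 1)⁻¹ * ∫ x in Ioi (0 : ℝ), rphi n α β (j + 1) x * (x ^ (n - (j + 1)))⁻¹ := by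
  obtain ⟨m, hm⟩ : ∃ m : ℕ, n - (j + 1) = m + 1 := ⟨n - (j + 1) - 1, by omega⟩
  have hnj : n - j = m + 2 := by omega
  have hmr : ((n : ℝ) - j - 1) = (m : ℝ) + 1 := by
    have : ((n - (j + 1) : ℕ) : ℝ) = (m : ℝ) + 1 := by exact_mod_cast hm
    rw [Nat.cast_sub (by omega)] at this
    push_cast at this
    linarith
  rw [hm, hnj, hmr]
  have hm1 : (0 : ℝ) < (m : ℝ) + 1 := by positivity
  set μ : ℝ := min α β with hμ
  have hμ0 : 0 < μ := lt_min hα hβ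
  -- `V(x) = -x^{-(m+1)}/(m+1)`, `V'(x) = x^{-(m+2)}`
  have hV : ∀ x ∈ Ioi (0 : ℝ), HasDerivAt (fun x : ℝ => -(x ^ (m + 1))⁻¹ / ((m : ℝ) + 1))
      ((x ^ (m + 2))⁻¹) x := by
    intro x hx
    have hx0 : (0 : ℝ) < x := hx
    have h := ((hasDerivAt_pow (m + 1) x).inv (pow_ne_zero _ hx0.ne')).neg.div_const ((m : ℝ) + 1)
    refine h.congr_deriv ?_
    have hx1 : x ^ (m + 1) ≠ 0 := pow_ne_zero _ hx0.ne'
    rw [Nat.add_sub_cancel]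
    push_cast
    field_simp
    ring
  have hibp := integral_Ioi_mul_deriv_eq_deriv_mul (a := 0) (a' := 0) (b' := 0)
    (u := rphi n α β j) (u' := rphi n α β (j + 1))
    (v := fun x : ℝ => -(x ^ (m + 1))⁻¹ / ((m : ℝ) + 1)) (v' := fun x : ℝ => (x ^ (m + 2))⁻¹)
    (fun x _ => hasDerivAt_rphi n α β j x) hV ?_ ?_ ?_ ?_
  · rw [hibp, sub_self, zero_sub, ← integral_neg, ← integral_const_mul]
    refine integral_congr_ae (Eventually.of_forall fun x => ?_)
    simp only
    field_simp
  · -- integrability of `φ_j x^{-(m+2)}`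
    have h := integrableOn_rphi_mul_inv_pow hn hα hβ (j := j) (by omega)
    rw [hnj] at h
    exact h
  · -- integrability of `φ_{j+1} · (-x^{-(m+1)}/(m+1))`
    have h := (integrableOn_rphi_mul_inv_pow hn hα hβ (j := j + 1) (by omega)).mul_const
      (-1 / ((m : ℝ) + 1))
    rw [hm] at h
    refine IntegrableOn.congr_fun h (fun x _ => ?_) measurableSet_Ioi
    simp only [Pi.mul_apply]
    ring
  · -- boundary term at `0`: `|φ_j(x) x^{-(m+1)}| ≤ A_n x → 0`
    have hlin : Tendsto (fun x : ℝ => rA n α β n / ((m : ℝ) + 1) * x) (𝓝[>] 0) (𝓝 0) := by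
      have : Tendsto (fun x : ℝ => rA n α β n / ((m : ℝ) + 1) * x) (𝓝 0) (𝓝 (rA n α β n / ((m : ℝ) + 1) * 0)) :=
        (continuous_const.mul continuous_id).tendsto 0
      rw [mul_zero] at this
      exact tendsto_nhdsWithin_of_tendsto_nhds this
    refine squeeze_zero_norm' ?_ hlin
    filter_upwards [self_mem_nhdsWithin] with x hx
    have hx0 : (0 : ℝ) < x := hx
    have hb := abs_rphi_le_pow hn hα hβ (n - j) (by omega) x hx0.le
    rw [show n - (n - j) = j by omega, hnj] at hb
    rw [Pi.mul_apply, norm_mul, Real.norm_eq_abs, Real.norm_eq_abs, abs_div, abs_neg, abs_inv,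
      abs_of_pos (pow_pos hx0 _), abs_of_pos hm1]
    have hx1 : x ^ (m + 1) ≠ 0 := pow_ne_zero _ hx0.ne'
    calc |rphi n α β j x| * ((x ^ (m + 1))⁻¹ / ((m : ℝ) + 1))
        ≤ rA n α β n * x ^ (m + 2) * ((x ^ (m + 1))⁻¹ / ((m : ℝ) + 1)) :=
          mul_le_mul_of_nonneg_right hb (by positivity)
      _ = rA n α β n / ((m : ℝ) + 1) * x := by field_simp; ring
  · -- boundary term at `∞`: `|φ_j(x) x^{-(m+1)}| ≤ A_j e^{-μx} → 0`
    have hexp : Tendsto (fun x : ℝ => rA n α β j / ((m : ℝ) + 1) * Real.exp (-μ * x)) atTop (𝓝 0) := by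
      have h := (Real.tendsto_exp_atBot.comp (tendsto_id.const_mul_atTop_of_neg (neg_neg_iff_pos.2 hμ0)))
      simpa using h.const_mul (rA n α β j / ((m : ℝ) + 1))
    refine squeeze_zero_norm' ?_ hexp
    filter_upwards [eventually_ge_atTop (1 : ℝ)] with x hx
    have hx0 : (0 : ℝ) < x := by linarith
    have hb := abs_rphi_le hn hα hβ j hx0.le
    have hinv : (x ^ (m + 1))⁻¹ ≤ 1 := inv_le_one_of_one_le₀ (one_le_pow₀ hx)
    rw [Pi.mul_apply, norm_mul, Real.norm_eq_abs, Real.norm_eq_abs, abs_div, abs_neg, abs_inv,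
      abs_of_pos (pow_pos hx0 _), abs_of_pos hm1]
    have hAj := rA_nonneg hn hα hβ j
    calc |rphi n α β j x| * ((x ^ (m + 1))⁻¹ / ((m : ℝ) + 1))
        ≤ rA n α β j * Real.exp (-(μ * x)) * (1 / ((m : ℝ) + 1)) :=
          mul_le_mul hb (div_le_div_of_nonneg_right hinv hm1.le) (by positivity) (by positivity)
      _ = rA n α β j / ((m : ℝ) + 1) * Real.exp (-μ * x) := by rw [neg_mul]; ring

/-- Iterating: `∫_0^∞ φ_0(x) x^{-n} dx = ((n-1)!)⁻¹ ∫_0^∞ φ_{n-1}(x) x^{-1} dx`. [folklore] -/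
private theorem integral_rphi_iterate {n : ℕ} (hn : 1 ≤ n) {α β : ℝ} (hα : 0 < α) (hβ : 0 < β) :
    ∀ i : ℕ, i ≤ n - 1 →
      ∫ x in Ioi (0 : ℝ), rphi n α β (n - 1 - i) x * (x ^ (n - (n - 1 - i)))⁻¹ =
        ((i.factorial : ℝ))⁻¹ * ∫ x in Ioi (0 : ℝ), rphi n α β (n - 1) x * (x ^ (n - (n - 1)))⁻¹ := by
  intro i
  induction i with
  | zero => intro _; simp
  | succ i ih =>
    intro hi
    have hj : n - 1 - (i + 1) + 2 ≤ n := by omega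
    rw [integral_rphi_ibp hn hα hβ hj, show n - 1 - (i + 1) + 1 = n - 1 - i by omega, ih (by omega),
      ← mul_assoc]
    congr 1
    rw [Nat.factorial_succ, Nat.cast_mul, mul_inv, Nat.cast_sub (by omega), Nat.cast_sub (by omega)]
    push_cast
    ring

/-- `∫_0^∞ e^{-tx} dx = 1/t` (`t > 0`). [folklore] -/
private theorem integral_exp_neg_mul_Ioi' {t : ℝ} (ht : 0 < t) :
    ∫ x in Ioi (0 : ℝ), Real.exp (-(t * x)) = 1 / t := by
  have h := integral_exp_mul_Ioi (a := -t) (by linarith) 0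
  simp only [mul_zero, Real.exp_zero] at h
  rw [show (fun x : ℝ => Real.exp (-(t * x))) = fun x : ℝ => Real.exp (-t * x) from
    funext fun x => by rw [neg_mul], h]
  field_simp

/-- **Frullani's integral** for exponentials, `0 < p < q`: `∫_0^∞ (e^{-px} - e^{-qx})/x dx = log q - log p`,
together with the integrability of the integrand, by Fubini: `(e^{-px} - e^{-qx})/x = ∫_p^q e^{-tx} dt` and
`∫_0^∞ e^{-tx} dx = 1/t`. [folklore] -/
private theorem frullani_exp_of_lt {p q : ℝ} (hp : 0 < p) (hpq : p < q) :
    IntegrableOn (fun x : ℝ => (Real.exp (-(p * x)) - Real.exp (-(q * x))) * x⁻¹) (Ioi 0) ∧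
      ∫ x in Ioi (0 : ℝ), (Real.exp (-(p * x)) - Real.exp (-(q * x))) * x⁻¹ = Real.log q - Real.log p := by
  set G : ℝ → ℝ → ℝ := fun x t => Real.exp (-(t * x)) with hG
  have hGc : Continuous (Function.uncurry G) := by
    simp only [hG, Function.uncurry_def]; fun_prop
  -- the inner integral in `t`
  have hinner : ∀ x ∈ Ioi (0 : ℝ), ∫ t in Ioc p q, G x t = (Real.exp (-(p * x)) - Real.exp (-(q * x))) * x⁻¹ := by
    intro x hx
    have hx0 : (0 : ℝ) < x := hx
    rw [← intervalIntegral.integral_of_le hpq.le]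
    have hderiv : ∀ t : ℝ, HasDerivAt (fun t : ℝ => -Real.exp (-(t * x)) / x) (G x t) t := by
      intro t
      have h1 : HasDerivAt (fun t : ℝ => -(t * x)) (-x) t := by
        have h := (hasDerivAt_id t).mul_const (-x)
        simpa [mul_neg] using h
      have h2 := ((Real.hasDerivAt_exp _).comp t h1).neg.div_const x
      refine h2.congr_deriv ?_
      simp only [hG]
      field_simp
    rw [intervalIntegral.integral_eq_sub_of_hasDerivAt (fun t _ => hderiv t)
      ((by simp only [hG]; fun_prop : Continuous fun t : ℝ => G x t).intervalIntegrable _ _)]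
    field_simp
    ring
  -- integrability on the product `(Ioi 0) × (Ioc p q)`
  have hint : Integrable (Function.uncurry G)
      ((volume.restrict (Ioi (0 : ℝ))).prod (volume.restrict (Ioc p q))) := by
    refine (integrable_prod_iff' hGc.aestronglyMeasurable).2 ⟨?_, ?_⟩
    · refine (ae_restrict_iff' measurableSet_Ioc).2 (Eventually.of_forall fun t ht => ?_)
      have ht0 : 0 < t := hp.trans ht.1
      simp only [Function.uncurry_apply_pair, hG]
      exact (exp_neg_integrableOn_Ioi 0 ht0).congr_fun (fun x _ => by simp only [neg_mul]) measurableSet_Ioi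
    · have hbound : IntegrableOn (fun _ : ℝ => 1 / p) (Ioc p q) := integrableOn_const measure_Ioc_lt_top.ne
      refine hbound.mono' ?_ ?_
      · have hmeas : AEStronglyMeasurable (fun t : ℝ => 1 / t) (volume.restrict (Ioc p q)) :=
          (Measurable.aestronglyMeasurable (by fun_prop))
        refine hmeas.congr ((ae_restrict_iff' measurableSet_Ioc).2 (Eventually.of_forall fun t ht => ?_))
        have ht0 : 0 < t := hp.trans ht.1
        simp only [Function.uncurry_apply_pair, hG, Real.norm_eq_abs, Real.abs_exp]
        rw [integral_exp_neg_mul_Ioi' ht0]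
      · refine (ae_restrict_iff' measurableSet_Ioc).2 (Eventually.of_forall fun t ht => ?_)
        have ht0 : 0 < t := hp.trans ht.1
        simp only [Function.uncurry_apply_pair, hG, Real.norm_eq_abs, Real.abs_exp]
        rw [integral_exp_neg_mul_Ioi' ht0, abs_of_pos (by positivity)]
        exact one_div_le_one_div_of_le hp ht.1.le
  -- the marginal in `x` is our integrand
  have hmarg : IntegrableOn (fun x : ℝ => (Real.exp (-(p * x)) - Real.exp (-(q * x))) * x⁻¹) (Ioi 0) := by
    have h := hint.integral_prod_left
    refine IntegrableOn.congr_fun h (fun x hx => ?_) measurableSet_Ioi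
    simp only [Function.uncurry_apply_pair]
    exact hinner x hx
  refine ⟨hmarg, ?_⟩
  calc ∫ x in Ioi (0 : ℝ), (Real.exp (-(p * x)) - Real.exp (-(q * x))) * x⁻¹
      = ∫ x in Ioi (0 : ℝ), ∫ t in Ioc p q, G x t := (setIntegral_congr_fun measurableSet_Ioi hinner).symm
    _ = ∫ t in Ioc p q, ∫ x in Ioi (0 : ℝ), G x t := integral_integral_swap hint
    _ = ∫ t in Ioc p q, 1 / t := by
        refine setIntegral_congr_fun measurableSet_Ioc fun t ht => ?_
        simp only [hG]
        exact integral_exp_neg_mul_Ioi' (hp.trans ht.1)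
    _ = Real.log q - Real.log p := by
        rw [← intervalIntegral.integral_of_le hpq.le, integral_one_div, Real.log_div (hp.trans hpq).ne' hp.ne']
        rw [uIcc_of_le hpq.le]
        exact fun h => by linarith [h.1]

/-- Frullani for all `p, q > 0` (antisymmetry handles `p > q`). [folklore] -/
private theorem frullani_exp {p q : ℝ} (hp : 0 < p) (hq : 0 < q) :
    IntegrableOn (fun x : ℝ => (Real.exp (-(p * x)) - Real.exp (-(q * x))) * x⁻¹) (Ioi 0) ∧
      ∫ x in Ioi (0 : ℝ), (Real.exp (-(p * x)) - Real.exp (-(q * x))) * x⁻¹ = Real.log q - Real.log p := by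
  rcases lt_trichotomy p q with h | rfl | h
  · exact frullani_exp_of_lt hp h
  · simp
  · obtain ⟨hi, hv⟩ := frullani_exp_of_lt hq h
    have hneg : (fun x : ℝ => (Real.exp (-(p * x)) - Real.exp (-(q * x))) * x⁻¹) =
        fun x : ℝ => -((Real.exp (-(q * x)) - Real.exp (-(p * x))) * x⁻¹) := by
      funext x; ring
    rw [hneg]
    refine ⟨hi.neg, ?_⟩
    rw [integral_neg, hv]
    ring

/-- The last step, a generalised Frullani integral: since `φ_{n-1}(0) = Σ_k w_k = 0`
(`w_k = (-1)^k C(n,k) (-λ_k)^{n-1}`), `∫_0^∞ φ_{n-1}(x)/x dx = Σ_k w_k ∫_0^∞ (e^{-λ_k x} - e^{-x})/x dx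
= -Σ_k w_k log λ_k`. [folklore] -/
private theorem integral_rphi_last {n : ℕ} (hn : 1 ≤ n) {α β : ℝ} (hα : 0 < α) (hβ : 0 < β) :
    ∫ x in Ioi (0 : ℝ), rphi n α β (n - 1) x * (x ^ (n - (n - 1)))⁻¹ =
      -∑ k ∈ Finset.range (n + 1), (-1 : ℝ) ^ k * (n.choose k : ℝ) * (-rlam n α β k) ^ (n - 1) *
        Real.log (rlam n α β k) := by
  rw [show n - (n - 1) = 1 by omega]
  simp only [pow_one]
  have hzero := rphi_at_zero (n := n) α β (j := n - 1) (by omega)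
  unfold rphi at hzero
  simp only [mul_zero, neg_zero, Real.exp_zero, mul_one] at hzero
  -- subtract `Σ_k w_k e^{-x} / x = 0` pointwise
  have hpt : ∀ x : ℝ, rphi n α β (n - 1) x * x⁻¹ = ∑ k ∈ Finset.range (n + 1),
      (-1 : ℝ) ^ k * (n.choose k : ℝ) * (-rlam n α β k) ^ (n - 1) *
        ((Real.exp (-(rlam n α β k * x)) - Real.exp (-(1 * x))) * x⁻¹) := by
    intro x
    unfold rphi
    rw [Finset.sum_mul]
    have : ∑ k ∈ Finset.range (n + 1), (-1 : ℝ) ^ k * (n.choose k : ℝ) * (-rlam n α β k) ^ (n - 1) *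
        (Real.exp (-(1 * x)) * x⁻¹) = 0 := by
      rw [← Finset.sum_mul, hzero, zero_mul]
    rw [← sub_zero (∑ k ∈ Finset.range (n + 1), (-1 : ℝ) ^ k * (n.choose k : ℝ) * (-rlam n α β k) ^ (n - 1) *
      Real.exp (-(rlam n α β k * x)) * x⁻¹), ← this, ← Finset.sum_sub_distrib]
    refine Finset.sum_congr rfl fun k _ => ?_
    ring
  simp_rw [hpt]
  rw [integral_finsetSum _ (fun k hk => ?_)]
  · rw [← Finset.sum_neg_distrib]
    refine Finset.sum_congr rfl fun k hk => ?_
    rw [Finset.mem_range] at hk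
    rw [integral_const_mul, (frullani_exp (rlam_pos hn hα hβ (by omega : k ≤ n)) one_pos).2, Real.log_one]
    ring
  · rw [Finset.mem_range] at hk
    exact ((frullani_exp (rlam_pos hn hα hβ (by omega : k ≤ n)) one_pos).1).const_mul _

/-- **(3.3.1.5) for every `n ≥ 1` and real `α, β > 0`** (Rice):
`∫_0^∞ ((e^{-αu} - e^{-βu})/u)^n du = (1/(n-1)!) Σ_k (-1)^{n-k} C(n,k) [(n-k)α + kβ]^{n-1} log[(n-k)α + kβ]`.
Proof: expand `(e^{-αu} - e^{-βu})^n = Σ_k (-1)^k C(n,k) e^{-λ_k u}`, `λ_k = (n-k)α + kβ`; the moments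
`Σ_k (-1)^k C(n,k) λ_k^j` vanish for `j < n` (an `n`-th difference of a polynomial of degree `< n`), so
`n - 1` integrations by parts on `(0, ∞)` have no boundary terms and give
`∫ φ/u^n = ((n-1)!)⁻¹ ∫ φ^{(n-1)}/u`, a generalised Frullani integral equal to
`-((n-1)!)⁻¹ Σ_k (-1)^k C(n,k) (-λ_k)^{n-1} log λ_k`. Discharge of the named fact `RiceLogIntegral`.
[cite: DavisRabinowitz1984, Sect. 3.3.1 (3.3.1.5)] -/
theorem RiceLogIntegral_holds : ∀ (n : ℕ) (α β : ℝ), RiceLogIntegral n α β := by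
  intro n α β hn hα hβ
  have hlhs : ∫ u in Ioi (0 : ℝ), ((Real.exp (-(α * u)) - Real.exp (-(β * u))) / u) ^ n =
      ∫ u in Ioi (0 : ℝ), rphi n α β (n - 1 - (n - 1)) u * (u ^ (n - (n - 1 - (n - 1))))⁻¹ := by
    refine setIntegral_congr_fun measurableSet_Ioi fun u _ => ?_
    rw [show n - 1 - (n - 1) = 0 by omega, Nat.sub_zero, rphi_zero_eq, div_pow, div_eq_mul_inv]
  rw [hlhs, integral_rphi_iterate hn hα hβ (n - 1) le_rfl, integral_rphi_last hn hα hβ,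
    ← Finset.sum_neg_distrib, riceLogRHS, one_div, Finset.mul_sum, Finset.mul_sum]
  refine Finset.sum_congr rfl fun k hk => ?_
  rw [Finset.mem_range] at hk
  have h2k : ((-1 : ℝ) ^ k) ^ 2 = 1 := by rw [← pow_mul, mul_comm, pow_mul]; norm_num
  have hsign : -((-1 : ℝ) ^ k * (-1) ^ (n - 1)) = (-1 : ℝ) ^ (n - k) := by
    calc -((-1 : ℝ) ^ k * (-1) ^ (n - 1)) = (-1 : ℝ) ^ k * ((-1) ^ (n - 1) * (-1)) := by ring
      _ = (-1 : ℝ) ^ k * (-1) ^ n := by rw [← pow_succ, Nat.sub_add_cancel hn]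
      _ = (-1 : ℝ) ^ k * ((-1) ^ (n - k) * (-1) ^ k) := by
          rw [← pow_add (-1 : ℝ) (n - k) k, Nat.sub_add_cancel (by omega : k ≤ n)]
      _ = (-1 : ℝ) ^ (n - k) * ((-1 : ℝ) ^ k) ^ 2 := by ring
      _ = (-1 : ℝ) ^ (n - k) := by rw [h2k, mul_one]
  rw [← hsign, neg_pow (rlam n α β k), rlam]
  ring

/-! ### (3.3.1.4): the `Γ(1-ε)` family -/

/-- A dominating function: `u ↦ u^a e^{-μu}` is integrable on `(0, ∞)` for `a > -1`, `μ > 0`. [folklore] -/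
private theorem integrableOn_rpow_mul_exp_neg {a μ : ℝ} (ha : -1 < a) (hμ : 0 < μ) :
    IntegrableOn (fun u : ℝ => u ^ a * Real.exp (-(μ * u))) (Ioi 0) := by
  have h := integrableOn_rpow_mul_exp_neg_mul_rpow ha le_rfl hμ
  refine h.congr_fun (fun u _ => ?_) measurableSet_Ioi
  simp only [Real.rpow_one, neg_mul]

/-- Integrability of `φ_j(u) u^{-s}` on `(0, ∞)` when `s < n - j + 1` (so that `A_n u^{n-j-s}` is integrable at
`0`). [folklore] -/
private theorem integrableOn_rphi_mul_rpow {n : ℕ} (hn : 1 ≤ n) {α β : ℝ} (hα : 0 < α) (hβ : 0 < β)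
    {j : ℕ} (hj : j ≤ n) {s : ℝ} (hs : s < (n : ℝ) - j + 1) :
    IntegrableOn (fun u : ℝ => rphi n α β j u * u ^ (-s)) (Ioi 0) := by
  set μ : ℝ := min α β with hμ
  have hμ0 : 0 < μ := lt_min hα hβ
  have hA := rA_nonneg hn hα hβ n
  have hAj := rA_nonneg hn hα hβ j
  have hnj : ((n - j : ℕ) : ℝ) = (n : ℝ) - j := by rw [Nat.cast_sub hj]
  -- dominating function
  have hdom : IntegrableOn (fun u : ℝ => rA n α β n * Real.exp μ * (u ^ (((n : ℝ) - j) - s) * Real.exp (-(μ * u))) +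
      rA n α β j * (u ^ |s| * Real.exp (-(μ * u)))) (Ioi 0) :=
    ((integrableOn_rpow_mul_exp_neg (by linarith) hμ0).const_mul _).add
      ((integrableOn_rpow_mul_exp_neg (by linarith [abs_nonneg s]) hμ0).const_mul _)
  refine hdom.mono' ?_ ((ae_restrict_iff' measurableSet_Ioi).2 (Eventually.of_forall fun u hu => ?_))
  · refine ContinuousOn.aestronglyMeasurable ?_ measurableSet_Ioi
    exact (continuous_rphi n α β j).continuousOn.mul
      (continuousOn_id.rpow_const fun x hx => Or.inl (ne_of_gt hx))
  have hu0 : (0 : ℝ) < u := hu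
  have hus : 0 < u ^ (-s) := Real.rpow_pos_of_pos hu0 _
  rw [norm_mul, Real.norm_eq_abs, Real.norm_eq_abs, abs_of_pos hus]
  have hterm2 : 0 ≤ rA n α β j * (u ^ |s| * Real.exp (-(μ * u))) := by positivity
  have hterm1 : 0 ≤ rA n α β n * Real.exp μ * (u ^ (((n : ℝ) - j) - s) * Real.exp (-(μ * u))) := by positivity
  rcases le_or_gt u 1 with hu1 | hu1
  · -- near `0`
    have hb := abs_rphi_le_pow hn hα hβ (n - j) (by omega) u hu0.le
    rw [show n - (n - j) = j by omega] at hb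
    have hpow : (u ^ (n - j) : ℝ) * u ^ (-s) = u ^ (((n : ℝ) - j) - s) := by
      rw [← Real.rpow_natCast, ← Real.rpow_add hu0, hnj]
      ring_nf
    calc |rphi n α β j u| * u ^ (-s) ≤ rA n α β n * u ^ (n - j) * u ^ (-s) :=
          mul_le_mul_of_nonneg_right hb hus.le
      _ = rA n α β n * 1 * (u ^ (((n : ℝ) - j) - s) * 1) := by rw [mul_assoc, hpow]; ring
      _ ≤ rA n α β n * Real.exp μ * (u ^ (((n : ℝ) - j) - s) * Real.exp (-(μ * u))) := by
          have h1 : (1 : ℝ) ≤ Real.exp μ * Real.exp (-(μ * u)) := by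
            rw [← Real.exp_add]; exact Real.one_le_exp_iff.2 (by nlinarith)
          have h2 : 0 ≤ u ^ (((n : ℝ) - j) - s) := (Real.rpow_pos_of_pos hu0 _).le
          nlinarith [mul_nonneg hA h2]
      _ ≤ _ := le_add_of_nonneg_right hterm2
  · -- `u ≥ 1`
    have hb := abs_rphi_le hn hα hβ j hu0.le
    have hpow : u ^ (-s) ≤ u ^ |s| := Real.rpow_le_rpow_of_exponent_le hu1.le (neg_le_abs s)
    calc |rphi n α β j u| * u ^ (-s) ≤ rA n α β j * Real.exp (-(μ * u)) * u ^ |s| :=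
          mul_le_mul hb hpow hus.le (by positivity)
      _ = rA n α β j * (u ^ |s| * Real.exp (-(μ * u))) := by ring
      _ ≤ _ := le_add_of_nonneg_left hterm1

/-- One integration by parts with a real power: for `j < n`, `s = n + ε - j` (`s ≠ 1`, `ε < 1`),
`∫_0^∞ φ_j(u) u^{-s} du = (s-1)⁻¹ ∫_0^∞ φ_{j+1}(u) u^{-(s-1)} du`. [folklore] -/
private theorem integral_rphi_rpow_ibp {n : ℕ} (hn : 1 ≤ n) {α β : ℝ} (hα : 0 < α) (hβ : 0 < β) {ε : ℝ}
    (hε : ε < 1) {j : ℕ} (hj : j < n) (hs1 : (n : ℝ) + ε - j ≠ 1) :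
    ∫ u in Ioi (0 : ℝ), rphi n α β j u * u ^ (-((n : ℝ) + ε - j)) =
      ((n : ℝ) + ε - j - 1)⁻¹ * ∫ u in Ioi (0 : ℝ), rphi n α β (j + 1) u * u ^ (-((n : ℝ) + ε - j - 1)) := by
  set s : ℝ := (n : ℝ) + ε - j with hs
  have h1s : 1 - s ≠ 0 := fun h => hs1 (by linarith)
  set μ : ℝ := min α β with hμ
  have hμ0 : 0 < μ := lt_min hα hβ
  have hA := rA_nonneg hn hα hβ n
  have hAj := rA_nonneg hn hα hβ j
  -- `V(u) = u^{1-s}/(1-s)`, `V' = u^{-s}` on `(0, ∞)`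
  have hV : ∀ u ∈ Ioi (0 : ℝ), HasDerivAt (fun u : ℝ => u ^ (1 - s) / (1 - s)) (u ^ (-s)) u := by
    intro u hu
    have hu0 : (0 : ℝ) < u := hu
    have h := (Real.hasDerivAt_rpow_const (p := 1 - s) (Or.inl hu0.ne')).div_const (1 - s)
    refine h.congr_deriv ?_
    rw [show (1 : ℝ) - s - 1 = -s by ring]
    field_simp
  have hibp := integral_Ioi_mul_deriv_eq_deriv_mul (a := 0) (a' := 0) (b' := 0)
    (u := rphi n α β j) (u' := rphi n α β (j + 1))
    (v := fun u : ℝ => u ^ (1 - s) / (1 - s)) (v' := fun u : ℝ => u ^ (-s))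
    (fun x _ => hasDerivAt_rphi n α β j x) hV ?_ ?_ ?_ ?_
  · rw [hibp, sub_self, zero_sub, ← integral_neg, ← integral_const_mul]
    refine integral_congr_ae (Eventually.of_forall fun u => ?_)
    simp only
    rw [show -(s - 1) = 1 - s by ring]
    have : s - 1 ≠ 0 := fun h => hs1 (by linarith)
    field_simp
    ring
  · exact integrableOn_rphi_mul_rpow hn hα hβ hj.le (by rw [hs]; linarith)
  · have h := (integrableOn_rphi_mul_rpow hn hα hβ (j := j + 1) (by omega) (s := s - 1)
      (by rw [hs]; push_cast; linarith)).mul_const (1 / (1 - s))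
    refine IntegrableOn.congr_fun h (fun u _ => ?_) measurableSet_Ioi
    simp only [Pi.mul_apply]
    rw [show -(s - 1) = 1 - s by ring]
    field_simp
  · -- boundary term at `0`: `|φ_j(u) u^{1-s}| ≤ A_n u^{1-ε} → 0`
    have h1ε : 0 < 1 - ε := by linarith
    have hlim : Tendsto (fun u : ℝ => rA n α β n / |1 - s| * u ^ (1 - ε)) (𝓝[>] 0) (𝓝 0) := by
      have hc : ContinuousAt (fun u : ℝ => u ^ (1 - ε)) 0 := Real.continuousAt_rpow_const 0 _ (Or.inr h1ε.le)
      have h := (hc.tendsto.const_mul (rA n α β n / |1 - s|))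
      rw [Real.zero_rpow h1ε.ne', mul_zero] at h
      exact tendsto_nhdsWithin_of_tendsto_nhds h
    refine squeeze_zero_norm' ?_ hlim
    filter_upwards [self_mem_nhdsWithin] with u hu
    have hu0 : (0 : ℝ) < u := hu
    have hb := abs_rphi_le_pow hn hα hβ (n - j) (by omega) u hu0.le
    rw [show n - (n - j) = j by omega] at hb
    have hnj : ((n - j : ℕ) : ℝ) = (n : ℝ) - j := by rw [Nat.cast_sub hj.le]
    have hpow : (u ^ (n - j) : ℝ) * u ^ (1 - s) = u ^ (1 - ε) := by
      rw [← Real.rpow_natCast, ← Real.rpow_add hu0, hnj, hs]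
      ring_nf
    rw [Pi.mul_apply, norm_mul, Real.norm_eq_abs, Real.norm_eq_abs, abs_div,
      abs_of_pos (Real.rpow_pos_of_pos hu0 _)]
    calc |rphi n α β j u| * (u ^ (1 - s) / |1 - s|) ≤ rA n α β n * u ^ (n - j) * (u ^ (1 - s) / |1 - s|) :=
          mul_le_mul_of_nonneg_right hb (by positivity)
      _ = rA n α β n / |1 - s| * (u ^ (n - j) * u ^ (1 - s)) := by ring
      _ = rA n α β n / |1 - s| * u ^ (1 - ε) := by rw [hpow]
  · -- boundary term at `∞`: `|φ_j(u) u^{1-s}| ≤ A_j u^{1-s} e^{-μu} → 0`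
    have hlim : Tendsto (fun u : ℝ => rA n α β j / |1 - s| * (u ^ (1 - s) * Real.exp (-μ * u))) atTop (𝓝 0) := by
      have h := (tendsto_rpow_mul_exp_neg_mul_atTop_nhds_zero (1 - s) μ hμ0).const_mul (rA n α β j / |1 - s|)
      rwa [mul_zero] at h
    refine squeeze_zero_norm' ?_ hlim
    filter_upwards [eventually_gt_atTop (0 : ℝ)] with u hu0
    have hb := abs_rphi_le hn hα hβ j hu0.le
    rw [Pi.mul_apply, norm_mul, Real.norm_eq_abs, Real.norm_eq_abs, abs_div,
      abs_of_pos (Real.rpow_pos_of_pos hu0 _)]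
    have hus : 0 ≤ u ^ (1 - s) := (Real.rpow_pos_of_pos hu0 _).le
    calc |rphi n α β j u| * (u ^ (1 - s) / |1 - s|) ≤ rA n α β j * Real.exp (-(μ * u)) * (u ^ (1 - s) / |1 - s|) :=
          mul_le_mul_of_nonneg_right hb (by positivity)
      _ = rA n α β j / |1 - s| * (u ^ (1 - s) * Real.exp (-μ * u)) := by rw [neg_mul]; ring

/-- Iterating the integration by parts `i ≤ n` times:
`∫_0^∞ φ_0 u^{-(n+ε)} = (Π_{j<i} (n+ε-1-j))⁻¹ ∫_0^∞ φ_i u^{-(n+ε-i)}`. [folklore] -/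
private theorem integral_rphi_rpow_iterate {n : ℕ} (hn : 1 ≤ n) {α β : ℝ} (hα : 0 < α) (hβ : 0 < β)
    {ε : ℝ} (hε : ε < 1) (hint : ∀ m : ℤ, ε ≠ m) :
    ∀ i : ℕ, i ≤ n → ∫ u in Ioi (0 : ℝ), rphi n α β 0 u * u ^ (-((n : ℝ) + ε)) =
      (∏ j ∈ Finset.range i, ((n : ℝ) + ε - 1 - j))⁻¹ *
        ∫ u in Ioi (0 : ℝ), rphi n α β i u * u ^ (-((n : ℝ) + ε - i)) := by
  intro i
  induction i with
  | zero => intro _; simp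
  | succ i ih =>
    intro hi
    have hs1 : (n : ℝ) + ε - i ≠ 1 := by
      intro h
      exact hint ((i : ℤ) + 1 - n) (by push_cast; linarith)
    rw [ih (by omega), integral_rphi_rpow_ibp hn hα hβ hε (by omega) hs1, Finset.prod_range_succ, mul_inv,
      mul_assoc]
    congr 2
    · ring
    · push_cast
      ring_nf

/-- `Π_{j<n} (n+ε-1-j) = (ε)_n = ε(ε+1)⋯(ε+n-1)`. [folklore] -/
private theorem prod_eq_ascPochhammer (n : ℕ) (ε : ℝ) :
    ∏ j ∈ Finset.range n, ((n : ℝ) + ε - 1 - j) = (ascPochhammer ℝ n).eval ε := by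
  have h : ∀ m : ℕ, (ascPochhammer ℝ m).eval ε = ∏ j ∈ Finset.range m, (ε + j) := by
    intro m
    induction m with
    | zero => simp
    | succ m ih => rw [ascPochhammer_succ_eval, ih, Finset.prod_range_succ]
  rw [h, ← Finset.prod_range_reflect]
  refine Finset.prod_congr rfl fun j hj => ?_
  rw [Finset.mem_range] at hj
  rw [Nat.cast_sub (by omega), Nat.cast_sub (by omega)]
  push_cast
  ring

/-- The Gamma integrals at the end: `∫_0^∞ φ_n(u) u^{-ε} du = Γ(1-ε) Σ_k (-1)^k C(n,k) (-λ_k)^n λ_k^{ε-1}`.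
[folklore] -/
private theorem integral_rphi_n_rpow {n : ℕ} (hn : 1 ≤ n) {α β : ℝ} (hα : 0 < α) (hβ : 0 < β) {ε : ℝ}
    (hε : ε < 1) :
    ∫ u in Ioi (0 : ℝ), rphi n α β n u * u ^ (-((n : ℝ) + ε - n)) =
      Real.Gamma (1 - ε) * ∑ k ∈ Finset.range (n + 1),
        (-1 : ℝ) ^ k * (n.choose k : ℝ) * (-rlam n α β k) ^ n * rlam n α β k ^ (ε - 1) := by
  rw [show -((n : ℝ) + ε - n) = -ε by ring]
  have hterm : ∀ k ∈ Finset.range (n + 1),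
      IntegrableOn (fun u : ℝ => (-1 : ℝ) ^ k * (n.choose k : ℝ) * (-rlam n α β k) ^ n *
        Real.exp (-(rlam n α β k * u)) * u ^ (-ε)) (Ioi 0) ∧
      ∫ u in Ioi (0 : ℝ), (-1 : ℝ) ^ k * (n.choose k : ℝ) * (-rlam n α β k) ^ n *
        Real.exp (-(rlam n α β k * u)) * u ^ (-ε) =
        (-1 : ℝ) ^ k * (n.choose k : ℝ) * (-rlam n α β k) ^ n * (Real.Gamma (1 - ε) * rlam n α β k ^ (ε - 1)) := by
    intro k hk
    rw [Finset.mem_range] at hk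
    have hl := rlam_pos hn hα hβ (by omega : k ≤ n)
    have hG := Real.integral_rpow_mul_exp_neg_mul_Ioi (a := 1 - ε) (r := rlam n α β k) (by linarith) hl
    rw [show (1 : ℝ) - ε - 1 = -ε by ring] at hG
    have hI : IntegrableOn (fun u : ℝ => u ^ (-ε) * Real.exp (-(rlam n α β k * u))) (Ioi 0) :=
      integrableOn_rpow_mul_exp_neg (by linarith) hl
    constructor
    · exact IntegrableOn.congr_fun (hI.const_mul ((-1 : ℝ) ^ k * (n.choose k : ℝ) * (-rlam n α β k) ^ n))
        (fun u _ => by ring) measurableSet_Ioi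
    · have : (fun u : ℝ => (-1 : ℝ) ^ k * (n.choose k : ℝ) * (-rlam n α β k) ^ n *
          Real.exp (-(rlam n α β k * u)) * u ^ (-ε)) = fun u : ℝ =>
          (-1 : ℝ) ^ k * (n.choose k : ℝ) * (-rlam n α β k) ^ n * (u ^ (-ε) * Real.exp (-(rlam n α β k * u))) := by
        funext u; ring
      rw [this, integral_const_mul, hG, one_div, Real.inv_rpow hl.le, ← Real.rpow_neg hl.le, neg_sub]
      ring
  unfold rphi
  simp_rw [Finset.sum_mul]
  rw [integral_finsetSum _ (fun k hk => (hterm k hk).1), Finset.mul_sum]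
  refine Finset.sum_congr rfl fun k hk => ?_
  rw [(hterm k hk).2]
  ring

/-- **(3.3.1.4) for every `n ≥ 1`, real `α, β > 0` and non-integral `ε < 1`** (Rice):
`∫_0^∞ u^{-n-ε} (e^{-αu} - e^{-βu})^n du = (Γ(1-ε)/(ε)_n) Σ_k (-1)^{n-k} C(n,k) λ_k^{n+ε-1}`. Proof: the
same expansion and vanishing moments as for (3.3.1.5); `n` integrations by parts with the real powers
`u^{-(n+ε-j)}` (no boundary terms: `φ_j(u) u^{1-(n+ε-j)} = O(u^{1-ε})` at `0`; the constants
`n+ε-j-1 ≠ 0` because `ε` is not an integer) produce `1/(ε)_n`, and the last integrals are Euler's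
`∫_0^∞ u^{-ε} e^{-λu} du = Γ(1-ε) λ^{ε-1}`. Discharge of the named fact `RiceEpsIntegral`.
[cite: DavisRabinowitz1984, Sect. 3.3.1 (3.3.1.4)] -/
theorem RiceEpsIntegral_holds : ∀ (n : ℕ) (ε α β : ℝ), RiceEpsIntegral n ε α β := by
  intro n ε α β hn hα hβ hε hint
  have hlhs : ∫ u in Ioi (0 : ℝ), u ^ (-(n : ℝ) - ε) * (Real.exp (-(α * u)) - Real.exp (-(β * u))) ^ n =
      ∫ u in Ioi (0 : ℝ), rphi n α β 0 u * u ^ (-((n : ℝ) + ε)) := by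
    refine setIntegral_congr_fun measurableSet_Ioi fun u _ => ?_
    rw [rphi_zero_eq, mul_comm, show -(n : ℝ) - ε = -((n : ℝ) + ε) by ring]
  have hpoch : (ascPochhammer ℝ n).eval ε ≠ 0 := by
    rw [← prod_eq_ascPochhammer, Finset.prod_ne_zero_iff]
    intro j hj h
    rw [Finset.mem_range] at hj
    exact hint ((j : ℤ) + 1 - n) (by push_cast; linarith)
  rw [hlhs, integral_rphi_rpow_iterate hn hα hβ hε hint n le_rfl, prod_eq_ascPochhammer,
    integral_rphi_n_rpow hn hα hβ hε, riceEpsRHS, Finset.mul_sum, Finset.mul_sum, Finset.mul_sum]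
  refine Finset.sum_congr rfl fun k hk => ?_
  rw [Finset.mem_range] at hk
  have hl := rlam_pos hn hα hβ (by omega : k ≤ n)
  have h2k : ((-1 : ℝ) ^ k) ^ 2 = 1 := by rw [← pow_mul, mul_comm, pow_mul]; norm_num
  have hsign : (-1 : ℝ) ^ k * (-1) ^ n = (-1 : ℝ) ^ (n - k) := by
    calc (-1 : ℝ) ^ k * (-1) ^ n = (-1 : ℝ) ^ k * ((-1) ^ (n - k) * (-1) ^ k) := by
          rw [← pow_add (-1 : ℝ) (n - k) k, Nat.sub_add_cancel (by omega : k ≤ n)]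
      _ = (-1 : ℝ) ^ (n - k) * ((-1 : ℝ) ^ k) ^ 2 := by ring
      _ = (-1 : ℝ) ^ (n - k) := by rw [h2k, mul_one]
  have hpow : (rlam n α β k) ^ n * rlam n α β k ^ (ε - 1) = rlam n α β k ^ ((n : ℝ) + ε - 1) := by
    rw [← Real.rpow_natCast, ← Real.rpow_add hl]
    ring_nf
  rw [← hsign, neg_pow (rlam n α β k), show (((n : ℝ) - k) * α + k * β) = rlam n α β k from rfl, ← hpow]
  field_simp

end RiceLogIntegralProof

end Literature.Analysis.Quadrature
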